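import Literature.Barriers.ValiantsHypothesis.CKRST20EquationsFromHittingSets
import Literature.Barriers.ValiantsHypothesis.SmallDefinableHittingSets
import Mathlib.Analysis.SpecificLimits.Normed
import HarnessLib

/-!
# CKRST 2020, arXiv v4 §1.3 remark "the theorem holds for polynomials with coefficients as large
# as `N`": Theorems 1.6 / 1.8 for INTEGER coefficient boxes of magnitude `N^a`, PROVED (as printed
# and in the tree's frame), and `CKRST2020_thm_1_1` / `CKRST2020_thm_1_3` DISCHARGED inside Literature

P. Chatterjee, M. Kumar, C. Ramya, R. Saptharishi, A. Tengse, *On the existence of algebraically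
natural proofs*, arXiv:2004.14147 v4, §1.3, right after Theorem 1.6 (TeX L258): "We note that even
though Theorem 1.6 is stated for polynomials with `{-1, 0, 1}` coefficients, the theorem holds for
polynomials with coefficients as large as `N`." (repeated after Thm. 1.8, L300: "as large as `N` and
also holds over other fields of characteristic zero"). Typed literature (cell val-lit t20; bears on
route `BarrierLever`, rung V4, the coefficient axis of items `SuccinctHittingSetsIffIntegerSlice`
(stmt-20029) / `IntegerBoxVanishingTransfer` (stmt-20033)). Honest framing: `VP ≠ VNP` is NOT proved
and nothing here is progress on it; this file only makes the PRINTED reach of the CKRST method on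
the coefficient axis a kernel theorem.

## What is proved (0 named facts)

* `intBoxSlice F n A` — the slice of polynomials whose coefficients are integers of modulus `≤ A`
  (the shape used inline by route item stmt-20029 with `A = 2^{n³}`); `signCoeffSlice ⊆ intBoxSlice 1`.
* `CKRST2020.intBox_frame` — for every `a₀` and every size exponent `b`, for all large `n`, a
  distinguisher `D ∈ Distinguishers ℂ n (a₀ + 6)` (size and degree `≤ N^{a₀+6}`, `N = binom(2n,n)`)
  that vanishes at the coefficient vector of every member of `SmallCircuits ℂ n b` with integer
  coefficients of modulus `≤ N^{a₀}` and is nonzero at some `{-1,0,1}`-polynomial of degree `≤ n`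
  (`IsNaturalProofRel … (intBoxSlice ℂ n (N^{a₀})) (SmallCircuits ℂ n b) (Distinguishers ℂ n (a₀+6))`):
  Theorem 1.6 in the tree's frame `d = n` with `{-1,0,1}` replaced by the box `[-N^{a₀}, N^{a₀}]`
  (print: `a₀ = 1`; the single-family-for-all-`b` version is `intBox_frame_uniform`, the
  as-printed degree-`n^c` version is `thm_1_1_intBox`, both below).
* `CKRST2020.intBox_frame_uniform`, `CKRST2020.intBox_frame'` — the ONE-FAMILY shape of
  `CKRST2020_thm_1_1.frame` (`∃ a D, ∀ b, ∃ n₀, ∀ n ≥ n₀`) for the box, via the barely super-polynomial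
  schedule `s(n) = n^{⌊log₂ n⌋ + 1}` of the printed proof ("`s_n = n^{log n}`").
* `CKRST2020.intBox_frame_vnp`, `CKRST2020.not_isSuccinctHittingSetRel_intBox_vnp` — the same
  for the `VNP`-succinct slice `SmallDefinable ℂ n b` (the remark after Thm. 1.8, TeX L300; box
  version of `CKRST2020_thm_1_3.frame` / `.not_isSuccinctHittingSetRel`), via
  `exists_equation_definableSlice_intBox` (v4 Lemma 3.7's hitting set on `[2s]^n`,
  `s = n + n^b + 1`) and `smallDefinable_subset_definableSlice`.
* `CKRST2020.thm_1_1_intBox` — Theorem 1.6 AS PRINTED (degree `n^c`, `N = binom(n + n^c, n)`,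
  one family `P_n` of size/degree `≤ N^{a₀+6}` vanishing, for every `k`, eventually on
  `𝒞(n, n^c, n^k) ∩ [-N^{a₀}, N^{a₀}]`, with a `{-1,0,1}` non-root of degree `≤ n^c`): the exact shape
  of `CKRST2020_thm_1_1` with `signCoeffSlice` replaced by the box; `natCard_monomialsDegLE`
  (`|x^{≤ d}| = binom(n+d, n)`).
* `CKRST2020.thm_1_3_intBox` — Theorem 1.8 AS PRINTED (`VNP`, degree `n^c`) for the box: the exact
  shape of `CKRST2020_thm_1_3` with `signCoeffSlice` replaced by the box in the vanishing clause
  (one family `Q_n`, size/degree `≤ N^{a₀+6}`, vanishing for every `k` eventually on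
  `vnpSlice ℂ n (n^c) (n^k) ∩ [-N^{a₀}, N^{a₀}]`, `{-1,0,1}` non-root of degree `≤ n^c`), via the
  `s`-definable slice with `s = n + n^{⌊log₂ n⌋+1} + 1`; `vnpSlice_mono_size`.
* `CKRST2020.intBox_frame_vnp'`, `CKRST2020.not_isSuccinctHittingSetRel_intBox_vnp'` — the
  `∃ a D, ∀ b` frame shape of `CKRST2020_thm_1_3.frame` for the box, transported from
  `thm_1_3_intBox` at `c = 1` along `n^1 = n` (`CKRST2020.toFrame`).
* `CKRST2020_thm_1_1_holds : CKRST2020_thm_1_1`, `CKRST2020_thm_1_3_holds : CKRST2020_thm_1_3` —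
  the printed Theorems 1.6 / 1.8 (the named facts of `CKRST20NaturalProofsExist.lean`) DISCHARGED
  inside `Literature/` as the box theorems at `a₀ = 0`; the tree's first proofs are the route-side
  `…AsPrinted.ckrst2020_thm_1_1_holds` / `…VNPAsPrinted.ckrst2020_thm_1_3_holds` under `Summits/`
  (not importable into `Literature/`). Unconditional corollaries:
  `CKRST2020.not_succinctHittingSetsForVPRel_signCoeffSlice`,
  `CKRST2020.exists_naturalProofAgainstVPRel_signCoeffSlice`.
* `CKRST2020.naturalProofAgainstVPRel_of_frame`, `CKRST2020.exists_naturalProofAgainstVPRel_intBox` —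
  FSV's relative technique class `NaturalProofAgainstVPRel` (Def. 1 relative to the box) is INHABITED
  at level `a₀ + 6` by the box distinguishers, for the chosen family of their `{-1,0,1}` non-roots.
* `CKRST2020.not_succinctHittingSetsForVPRel_intBox` — hence `SuccinctHittingSetsForVPRel ℂ
  (fun n => intBoxSlice ℂ n (binom(2n,n)^{a₀}))` is FALSE for every `a₀`: the relative form of
  FSV Question 6 fails on every coefficient slice of bit-length `O(a₀ · n)` (cf. the route's PROVED
  `SuccinctHittingSetsIffIntegerSlice`: failure on the slice of bit-length `n³` would refute
  Question 6 itself). The distinguisher size is polynomial in `N` and LINEAR in the coefficient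
  bound (`CKRST2020.exists_equation_vpSlice_intBox`), which is why the printed method stops at
  magnitude `poly(N)`; nothing here narrows that gap.

Proof: `CKRST2020.exists_equation_vpSlice_intBox` (v4 Thm. 4.3 with coefficient bound `A`, on the
Heintz–Schnorr hitting set `ℋ ⊆ [(n^{b+1})²]^n`, `|ℋ| ≤ n^{be}`) at `d = n`, `s = n^{max b 1}`,
`A = N^{a₀}`; the witness from `CKRST2020.exists_signCoeff_vanishing_on` (Siegel pigeonhole,
`(2N B^n + 1)^{|ℋ|} < 2^N`); and the absorption of all `poly(n)` factors into one power of
`N ≥ 2^n` (`eventually_mul_pow_le_two_pow`, from Mathlib's `tendsto_pow_const_div_const_pow_of_one_lt`).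

## References

* [ChatterjeeKumarRamyaSaptharishiTengse2020] arXiv:2004.14147 v4 §1.3, remarks after Thm. 1.6
  (TeX L258) and Thm. 1.8 (L300); Thm. 4.3. TeX: cell HOME/lit/src/2004.14147/main.tex.
* [ForbesShpilkaVolk2018] Def. 1/3 and Question 6 (the relative frame `IsNaturalProofRel`,
  `SuccinctHittingSetsForVPRel` of `AlgebraicNaturalProofs.lean`).
-/

noncomputable section

namespace Literature.Barriers.ValiantsHypothesis

open Literature.Computability.AlgebraicComplexity MvPolynomial Filter

/-! ### The integer-box slice -/

section IntBox

variable (F : Type*) [Field F]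

/-- **The integer-box slice**: polynomials all of whose coefficients are (casts of) integers of
modulus `≤ A` (CKRST §1.3: "polynomials with coefficients as large as `N`"; the route's item
stmt-20029 uses this shape with `A = 2^{n³}`).
[cite: ChatterjeeKumarRamyaSaptharishiTengse2020, §1.3, remark after Thm. 1.6] locator: HOME/lit/src/2004.14147/main.tex L258 -/
def intBoxSlice (n A : ℕ) : Set (MvPolynomial (Fin n) F) :=
  {f | ∀ m, ∃ z : ℤ, coeff m f = (z : F) ∧ |z| ≤ A}

/-- Unfolding. [cite: ChatterjeeKumarRamyaSaptharishiTengse2020, §1.3, remark after Thm. 1.6] -/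
theorem mem_intBoxSlice_iff {n A : ℕ} (f : MvPolynomial (Fin n) F) :
    f ∈ intBoxSlice F n A ↔ ∀ m, ∃ z : ℤ, coeff m f = (z : F) ∧ |z| ≤ A := Iff.rfl

/-- The box slices grow with the bound. [cite: ChatterjeeKumarRamyaSaptharishiTengse2020, §1.3, remark after Thm. 1.6] -/
theorem intBoxSlice_mono {n A A' : ℕ} (h : A ≤ A') : intBoxSlice F n A ⊆ intBoxSlice F n A' := by
  intro f hf m
  obtain ⟨z, hz, hzA⟩ := hf m
  exact ⟨z, hz, hzA.trans (by exact_mod_cast h)⟩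

/-- `{-1,0,1}`-polynomials lie in every box with `A ≥ 1`.
[cite: ChatterjeeKumarRamyaSaptharishiTengse2020, §1.3, remark after Thm. 1.6] -/
theorem signCoeffSlice_subset_intBoxSlice {n A : ℕ} (hA : 1 ≤ A) :
    signCoeffSlice F n ⊆ intBoxSlice F n A := by
  intro f hf m
  rcases hf m with h | h | h
  · exact ⟨0, by rw [h, Int.cast_zero], by simp⟩
  · exact ⟨1, by rw [h, Int.cast_one], by simpa using hA⟩
  · exact ⟨-1, by rw [h, Int.cast_neg, Int.cast_one], by simpa using hA⟩

end IntBox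

namespace CKRST2020

/-! ### Growth lemmas: every polynomial in `n` is eventually below `2^n ≤ binom(2n, n)` -/

/-- `C · n^k ≤ 2^n` for all large `n` (from `n^k / 2^n → 0`). [folklore] -/
private theorem eventually_mul_pow_le_two_pow (C k : ℕ) : ∃ n₀ : ℕ, ∀ n ≥ n₀, C * n ^ k ≤ 2 ^ n := by
  have h := tendsto_pow_const_div_const_pow_of_one_lt k (one_lt_two : (1 : ℝ) < 2)
  have hev := h.eventually (gt_mem_nhds (show (0 : ℝ) < 1 / ((C : ℝ) + 1) by positivity))
  rw [Filter.eventually_atTop] at hev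
  obtain ⟨n₀, hn₀⟩ := hev
  refine ⟨n₀, fun n hn => ?_⟩
  have h1 := hn₀ n hn
  rw [div_lt_iff₀ (by positivity)] at h1
  have h2 : ((C : ℝ) + 1) * (n : ℝ) ^ k < (2 : ℝ) ^ n := by
    have := mul_lt_mul_of_pos_left h1 (show (0 : ℝ) < C + 1 by positivity)
    rwa [← mul_assoc, mul_one_div_cancel (by positivity), one_mul] at this
  have h3 : ((C * n ^ k : ℕ) : ℝ) ≤ ((2 ^ n : ℕ) : ℝ) := by
    push_cast
    nlinarith [show (0 : ℝ) ≤ (n : ℝ) ^ k by positivity]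
  exact_mod_cast h3

/-- `2^n ≤ binom(2n, n)`. [folklore] -/
private theorem two_pow_le_centralBinom' (n : ℕ) : 2 ^ n ≤ (2 * n).choose n := by
  rw [← Nat.centralBinom_eq_two_mul_choose]
  induction n with
  | zero => simp
  | succ n ih =>
    have h := Nat.succ_mul_centralBinom_succ n
    -- `(n+1) C_{n+1} = 2(2n+1) C_n ≥ 2(n+1) C_n`
    have h2 : (n + 1) * (2 * Nat.centralBinom n) ≤ (n + 1) * Nat.centralBinom (n + 1) := by
      rw [h]; nlinarith [Nat.zero_le (Nat.centralBinom n)]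
    have h3 : 2 * Nat.centralBinom n ≤ Nat.centralBinom (n + 1) :=
      Nat.le_of_mul_le_mul_left h2 (Nat.succ_pos n)
    calc 2 ^ (n + 1) = 2 * 2 ^ n := by ring
      _ ≤ 2 * Nat.centralBinom n := Nat.mul_le_mul_left _ ih
      _ ≤ Nat.centralBinom (n + 1) := h3

/-- `C · n^k ≤ binom(2n, n)` for all large `n`. [folklore] -/
private theorem eventually_mul_pow_le_choose (C k : ℕ) :
    ∃ n₀ : ℕ, ∀ n ≥ n₀, C * n ^ k ≤ (2 * n).choose n := by
  obtain ⟨n₀, h⟩ := eventually_mul_pow_le_two_pow C k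
  exact ⟨n₀, fun n hn => (h n hn).trans (two_pow_le_centralBinom' n)⟩

/-- `log₂ (N^{a+1} · ((n^{b} · n)²)^n) ≤ 2n(a+1) + 2n²(b+1)` for `N = binom(2n,n) ≤ 4^n` and
`n ≤ 2^n`. [folklore] -/
private theorem log_two_boxData_le (n a b : ℕ) :
    Nat.log 2 ((2 * n).choose n * ((2 * n).choose n) ^ a * (((n ^ b * n) ^ 2) ^ n)) ≤
      2 * n * (a + 1) + 2 * n ^ 2 * (b + 1) := by
  have hN : (2 * n).choose n ≤ 2 ^ (2 * n) := Nat.choose_le_two_pow _ _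
  have hn : n ≤ 2 ^ n := Nat.lt_two_pow_self.le
  have h1 : (2 * n).choose n * ((2 * n).choose n) ^ a ≤ 2 ^ (2 * n * (a + 1)) := by
    rw [← pow_succ', pow_mul]
    exact Nat.pow_le_pow_left hN _
  have h2 : ((n ^ b * n) ^ 2) ^ n ≤ 2 ^ (2 * n ^ 2 * (b + 1)) := by
    have : n ^ b * n ≤ 2 ^ (n * (b + 1)) := by
      rw [pow_mul, ← pow_succ]
      exact Nat.pow_le_pow_left hn _
    calc ((n ^ b * n) ^ 2) ^ n ≤ ((2 ^ (n * (b + 1))) ^ 2) ^ n := by gcongr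
      _ = 2 ^ (2 * n ^ 2 * (b + 1)) := by rw [← pow_mul, ← pow_mul]; ring_nf
  have h := Nat.mul_le_mul h1 h2
  rw [← pow_add] at h
  have := Nat.log_mono_right (b := 2) h
  rwa [Nat.log_pow Nat.one_lt_two] at this

/-- The thresholds used below, all at once: for fixed `a, b, e` and all large `n`, with
`N = binom(2n, n)`: `n^{be} + 1 ≤ N`, `2n(a+1) + 2n²(b+1) + 2 ≤ N`, `(2b+6)·n^{be+2} < N`, `80 ≤ N`,
`2 ≤ n`. [folklore] -/
private theorem thresholds (a b e : ℕ) : ∃ n₀ : ℕ, ∀ n ≥ n₀,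
    n ^ (b * e) + 1 ≤ (2 * n).choose n ∧
    2 * n * (a + 1) + 2 * n ^ 2 * (b + 1) + 2 ≤ (2 * n).choose n ∧
    (2 * b + 6) * n ^ (b * e + 2) < (2 * n).choose n ∧
    80 ≤ (2 * n).choose n ∧ 2 ≤ n := by
  obtain ⟨n₁, h₁⟩ := eventually_mul_pow_le_choose 2 (b * e)
  obtain ⟨n₂, h₂⟩ := eventually_mul_pow_le_choose (2 * (a + 1) + 2 * (b + 1) + 2) 2
  obtain ⟨n₃, h₃⟩ := eventually_mul_pow_le_choose (2 * b + 7) (b * e + 2)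
  obtain ⟨n₄, h₄⟩ := eventually_mul_pow_le_choose 80 0
  refine ⟨max (max n₁ n₂) (max (max n₃ n₄) 2), fun n hn => ?_⟩
  simp only [ge_iff_le, max_le_iff] at hn
  obtain ⟨⟨hn₁, hn₂⟩, ⟨hn₃, hn₄⟩, hn2⟩ := hn
  have hnk : 1 ≤ n ^ (b * e) := Nat.one_le_pow _ _ (by omega)
  have hnk2 : 1 ≤ n ^ (b * e + 2) := Nat.one_le_pow _ _ (by omega)
  refine ⟨?_, ?_, ?_, ?_, hn2⟩
  · have := h₁ n hn₁; omega
  · have := h₂ n hn₂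
    have hnn : n ≤ n ^ 2 := by nlinarith
    have h22 : 2 ≤ 2 * n ^ 2 := by nlinarith
    have hA : 2 * n * (a + 1) ≤ 2 * n ^ 2 * (a + 1) := by
      have := Nat.mul_le_mul_right (a + 1) (Nat.mul_le_mul_left 2 hnn)
      simpa [mul_assoc] using this
    have hsq : 2 * n * (a + 1) + 2 * n ^ 2 * (b + 1) + 2 ≤ (2 * (a + 1) + 2 * (b + 1) + 2) * n ^ 2 := by
      have e1 : (2 * (a + 1) + 2 * (b + 1) + 2) * n ^ 2 =
          2 * n ^ 2 * (a + 1) + 2 * n ^ 2 * (b + 1) + 2 * n ^ 2 := by ring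
      rw [e1]
      omega
    exact hsq.trans this
  · have := h₃ n hn₃; nlinarith
  · simpa using h₄ n hn₄

/-! ### Theorem 1.6 in the tree's frame for the box `[-N^{a₀}, N^{a₀}]` -/

/-- **CKRST 2020 §1.3 remark ("the theorem holds for polynomials with coefficients as large as
`N`") — Theorem 1.6 in the tree's frame `d = n` for INTEGER COEFFICIENT BOXES.** For every `a₀` and
every size exponent `b` there is `n₀` such that for all `n ≥ n₀` some `D ∈ Distinguishers ℂ n (a₀+6)`
(size and degree `≤ binom(2n,n)^{a₀+6}`) vanishes at the coefficient vector of every member of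
`SmallCircuits ℂ n b` whose coefficients are integers of modulus `≤ binom(2n,n)^{a₀}`, and is
nonzero at the coefficient vector of some `{-1,0,1}`-polynomial of degree `≤ n` (a member of the
box). Print: `a₀ = 1` (coefficients "as large as `N`"); the tree's `{-1,0,1}` version is
`CKRST2020_thm_1_1.frame`. [cite: ChatterjeeKumarRamyaSaptharishiTengse2020, §1.3, remark after Thm. 1.6 (with Thm. 4.3)] locator: HOME/lit/src/2004.14147/main.tex L258 -/
theorem intBox_frame (a₀ b : ℕ) : ∃ n₀ : ℕ, ∀ n ≥ n₀,
    ∃ D : MvPolynomial (degLEMonomials n) ℂ,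
      IsNaturalProofRel (degLEMonomials n) (intBoxSlice ℂ n (((2 * n).choose n) ^ a₀))
        (SmallCircuits ℂ n b) (Distinguishers ℂ n (a₀ + 6)) D ∧
      ∃ h ∈ signCoeffSlice ℂ n, h.totalDegree ≤ n ∧
        eval (coeffVector (degLEMonomials n) h) D ≠ 0 := by
  classical
  obtain ⟨e, hmain⟩ := exists_equation_vpSlice_intBox
  set b' := max b 1 with hb'
  obtain ⟨n₀, hthr⟩ := thresholds a₀ b' e
  refine ⟨n₀, fun n hn => ?_⟩
  obtain ⟨hT1, hT2, hT3, hT80, hn2⟩ := hthr n hn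
  set N := (2 * n).choose n with hN
  have hNcard : Nat.card (monomialsDegLE n n) = N := by
    rw [monomialsDegLE_self, GKSS2017.card_degLEMonomials]
  have hb'1 : 1 ≤ b' := le_max_right _ _
  have hns : n ≤ n ^ b' := by
    calc n = n ^ 1 := (pow_one n).symm
      _ ≤ n ^ b' := Nat.pow_le_pow_right (by omega) hb'1
  have hs2 : 2 ≤ n ^ b' := hn2.trans hns
  obtain ⟨H, P, hHB, hHcard, hP0, hPL, hPdeg, hPiff, hvan⟩ :=
    hmain n n (n ^ b') (N ^ a₀) (by omega) hns (by omega) hns hs2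
  rw [hNcard] at hPL hPdeg
  -- bookkeeping constants
  have hN1 : 1 ≤ N := by omega
  have hA1 : 1 ≤ N ^ a₀ := Nat.one_le_pow _ _ hN1
  have hNA : 1 ≤ N * N ^ a₀ := Nat.mul_pos (by omega) (by omega)
  have hNA' : N * N ^ a₀ + 1 ≤ 2 * N ^ (a₀ + 1) := by rw [pow_succ']; omega
  have ht : (n ^ b') ^ e + 1 ≤ N := by rw [← pow_mul]; exact hT1
  have hW : Nat.log 2 (N * N ^ a₀ * ((n ^ b' * n) ^ 2) ^ n) + 2 ≤ N :=
    (Nat.add_le_add_right (log_two_boxData_le n a₀ b') 2).trans hT2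
  -- (1) `P ∈ Distinguishers ℂ n (a₀ + 6)`
  have hsize : complexity P ≤ N ^ (a₀ + 6) := by
    refine hPL.trans ?_
    calc 20 * ((n ^ b') ^ e + 1) * (N * N ^ a₀ + 1) * (N + 1) *
          (Nat.log 2 (N * N ^ a₀ * ((n ^ b' * n) ^ 2) ^ n) + 2) ^ 2
        ≤ 20 * N * (2 * N ^ (a₀ + 1)) * (2 * N) * N ^ 2 := by
          gcongr
          · omega
      _ = 80 * N ^ (a₀ + 5) := by ring
      _ ≤ N * N ^ (a₀ + 5) := Nat.mul_le_mul_right _ hT80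
      _ = N ^ (a₀ + 6) := by ring
  have hdegP : P.totalDegree ≤ N ^ (a₀ + 6) := by
    refine hPdeg.trans ?_
    calc 10 * ((n ^ b') ^ e + 1) * (N * N ^ a₀ + 1) *
          (Nat.log 2 (N * N ^ a₀ * ((n ^ b' * n) ^ 2) ^ n) + 2) ^ 2
        ≤ 10 * N * (2 * N ^ (a₀ + 1)) * N ^ 2 := by
          gcongr
      _ = 20 * N ^ (a₀ + 4) := by ring
      _ ≤ N * N ^ (a₀ + 4) := Nat.mul_le_mul_right _ (by omega)
      _ = N ^ (a₀ + 5) := by ring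
      _ ≤ N ^ (a₀ + 6) := Nat.pow_le_pow_right hN1 (by omega)
  -- (2) the `{-1,0,1}` witness vanishing on `ℋ`
  have hHabs : ∀ a ∈ H, ∀ j, |a j| ≤ (((n ^ b' * n) ^ 2 : ℕ) : ℤ) := by
    intro a ha j
    obtain ⟨h1, h2⟩ := hHB a ha j
    rw [abs_le]; constructor <;> linarith
  have hB1 : 1 ≤ (n ^ b' * n) ^ 2 := Nat.one_le_pow _ _ (Nat.mul_pos (by omega) (by omega))
  have hcount : (2 * (Nat.card (monomialsDegLE n n) * ((n ^ b' * n) ^ 2) ^ n) + 1) ^ H.card <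
      2 ^ Nat.card (monomialsDegLE n n) := by
    rw [hNcard]
    -- `2 N B^n + 1 ≤ 2^{2 + 2n + 2n²(b'+1)}` and `|ℋ| · (2 + 2n + 2n²(b'+1)) < N`
    have hE : 2 * (N * ((n ^ b' * n) ^ 2) ^ n) + 1 ≤ 2 ^ (2 * n * 1 + 2 * n ^ 2 * (b' + 1) + 2) := by
      have h0 := log_two_boxData_le n 0 b'
      rw [pow_zero, mul_one, ← hN] at h0
      have hlt := Nat.lt_pow_succ_log_self Nat.one_lt_two (N * ((n ^ b' * n) ^ 2) ^ n)
      have hmono : 2 ^ (Nat.log 2 (N * ((n ^ b' * n) ^ 2) ^ n) + 1) ≤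
          2 ^ (2 * n * (0 + 1) + 2 * n ^ 2 * (b' + 1) + 1) :=
        Nat.pow_le_pow_right (by norm_num) (by omega)
      have : 2 ^ (2 * n * 1 + 2 * n ^ 2 * (b' + 1) + 2) =
          2 * 2 ^ (2 * n * (0 + 1) + 2 * n ^ 2 * (b' + 1) + 1) := by ring
      rw [this]
      omega
    have hexp : H.card * (2 * n * 1 + 2 * n ^ 2 * (b' + 1) + 2) < N := by
      have hc : H.card ≤ n ^ (b' * e) := by rw [pow_mul]; exact hHcard
      have h6 : 2 * n * 1 + 2 * n ^ 2 * (b' + 1) + 2 ≤ (2 * b' + 6) * n ^ 2 := by nlinarith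
      calc H.card * (2 * n * 1 + 2 * n ^ 2 * (b' + 1) + 2)
          ≤ n ^ (b' * e) * ((2 * b' + 6) * n ^ 2) := Nat.mul_le_mul hc h6
        _ = (2 * b' + 6) * n ^ (b' * e + 2) := by ring
        _ < N := hT3
    calc (2 * (N * ((n ^ b' * n) ^ 2) ^ n) + 1) ^ H.card
        ≤ (2 ^ (2 * n * 1 + 2 * n ^ 2 * (b' + 1) + 2)) ^ H.card := Nat.pow_le_pow_left hE _
      _ = 2 ^ (H.card * (2 * n * 1 + 2 * n ^ 2 * (b' + 1) + 2)) := by rw [← pow_mul, mul_comm]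
      _ < 2 ^ N := Nat.pow_lt_pow_right (by norm_num) hexp
  obtain ⟨g, hg0, hgd, hgs, hgv⟩ :=
    exists_signCoeff_vanishing_on ℂ n n ((n ^ b' * n) ^ 2) hB1 H hHabs hcount
  have hgbox : g ∈ intBoxSlice ℂ n (N ^ a₀) := signCoeffSlice_subset_intBoxSlice ℂ hA1 hgs
  have hgP : eval (coeffVector (degLEMonomials n) g) P ≠ 0 := by
    intro h0
    have := (hPiff g hgd hgbox).mp h0 hg0
    obtain ⟨a, ha, hne⟩ := this
    exact hne (hgv a ha)
  -- (3) assemble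
  refine ⟨P, ⟨⟨hsize, hdegP⟩, ⟨g, hgbox, hgP⟩, fun f hf hfbox => ?_⟩, g, hgs, hgd, hgP⟩
  have hf' : f ∈ vpSlice ℂ n n (n ^ b') :=
    smallCircuits_mono ℂ (le_max_left b 1) (by omega) hf
  exact hvan f hf' hfbox

/-- **Consequence: the relative form of FSV Question 6 FAILS on every integer-box slice of
magnitude `binom(2n,n)^{a₀}`** (coefficient bit-length `O(a₀ n)`), extending the tree's
`CKRST2020_thm_1_1.not_succinctHittingSetsForVPRel` (the `{-1,0,1}` slice) — by relative FSV
Thm. 4 (`exists_isNaturalProofRel_iff`). Compare the route's PROVED `SuccinctHittingSetsIffIntegerSlice`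
(stmt-20029): failure on the slice of magnitude `2^{n³}` would refute Question 6 itself; the CKRST
distinguishers have size LINEAR in the coefficient bound, so they do not reach that slice.
[cite: ChatterjeeKumarRamyaSaptharishiTengse2020, §1.3, remark after Thm. 1.6, and §1.4] locator: HOME/lit/src/2004.14147/main.tex L258 -/
theorem not_succinctHittingSetsForVPRel_intBox (a₀ : ℕ) :
    ¬ SuccinctHittingSetsForVPRel ℂ (fun n => intBoxSlice ℂ n (((2 * n).choose n) ^ a₀)) := by
  intro hyp
  obtain ⟨b, n₀, hb⟩ := hyp (a₀ + 6)
  obtain ⟨n₁, hn₁⟩ := intBox_frame a₀ b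
  obtain ⟨D, hD, -⟩ := hn₁ (max n₀ n₁) (le_max_right _ _)
  exact (exists_isNaturalProofRel_iff _ _ _ _).1 ⟨D, hD⟩ (hb (max n₀ n₁) (le_max_left _ _))

/-! ### The same for the `VNP` slice `SmallDefinable ℂ n b` (remark after Thm. 1.8, TeX L300) -/

/-- Arithmetic: `(nb+3)(n+e) + 2 ≤ ((b+3)(e+1)+2)·n²` for `n ≥ 1`. [folklore] -/
private theorem arith_poly1 (n b e : ℕ) (hn : 1 ≤ n) :
    (n * b + 3) * (n + e) + 2 ≤ ((b + 3) * (e + 1) + 2) * n ^ 2 := by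
  have h1 : n * b + 3 ≤ (b + 3) * n := by nlinarith
  have h2 : n + e ≤ (e + 1) * n := by nlinarith
  have h3 := Nat.mul_le_mul h1 h2
  have h4 : 2 ≤ 2 * n ^ 2 := by nlinarith
  calc (n * b + 3) * (n + e) + 2 ≤ (b + 3) * n * ((e + 1) * n) + 2 * n ^ 2 := Nat.add_le_add h3 h4
    _ = ((b + 3) * (e + 1) + 2) * n ^ 2 := by ring

/-- Arithmetic: `2n(a+1) + n(nb+3) + 2 ≤ (2(a+1)+b+5)·n²` for `n ≥ 1`. [folklore] -/
private theorem arith_poly2 (n a b : ℕ) (hn : 1 ≤ n) :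
    2 * n * (a + 1) + n * (n * b + 3) + 2 ≤ (2 * (a + 1) + b + 5) * n ^ 2 := by
  have hnn : n ≤ n ^ 2 := by nlinarith
  have h1 : 2 * n * (a + 1) ≤ 2 * (a + 1) * n ^ 2 := by
    calc 2 * n * (a + 1) = 2 * (a + 1) * n := by ring
      _ ≤ 2 * (a + 1) * n ^ 2 := Nat.mul_le_mul_left _ hnn
  have h2 : n * (n * b + 3) ≤ (b + 3) * n ^ 2 := by
    have h3n : 3 * n ≤ 3 * n ^ 2 := Nat.mul_le_mul_left _ hnn
    calc n * (n * b + 3) = b * n ^ 2 + 3 * n := by ring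
      _ ≤ b * n ^ 2 + 3 * n ^ 2 := by omega
      _ = (b + 3) * n ^ 2 := by ring
  have h3 : 2 ≤ 2 * n ^ 2 := by nlinarith
  calc 2 * n * (a + 1) + n * (n * b + 3) + 2
      ≤ 2 * (a + 1) * n ^ 2 + (b + 3) * n ^ 2 + 2 * n ^ 2 := Nat.add_le_add (Nat.add_le_add h1 h2) h3
    _ = (2 * (a + 1) + b + 5) * n ^ 2 := by ring

/-- Arithmetic: `A·x + 2 ≤ (A+2)·x` and `C·x < (C+1)·x` for `x ≥ 1`. [folklore] -/
private theorem arith_absorb (A x : ℕ) (hx : 1 ≤ x) : A * x + 2 ≤ (A + 2) * x ∧ A * x < (A + 1) * x := by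
  constructor <;> nlinarith

/-- `log₂ (N^{a+1} · X^n) ≤ 2n(a+1) + n·k` when `X ≤ 2^k`, `N = binom(2n,n)`. [folklore] -/
private theorem log_two_mul_pow_le (n a k X : ℕ) (hX : X ≤ 2 ^ k) :
    Nat.log 2 ((2 * n).choose n * ((2 * n).choose n) ^ a * X ^ n) ≤ 2 * n * (a + 1) + n * k := by
  have hN : (2 * n).choose n ≤ 2 ^ (2 * n) := Nat.choose_le_two_pow _ _
  have h1 : (2 * n).choose n * ((2 * n).choose n) ^ a ≤ 2 ^ (2 * n * (a + 1)) := by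
    rw [← pow_succ', pow_mul]
    exact Nat.pow_le_pow_left hN _
  have h2 : X ^ n ≤ 2 ^ (n * k) := by
    rw [mul_comm, pow_mul]; exact Nat.pow_le_pow_left hX _
  have h := Nat.mul_le_mul h1 h2
  rw [← pow_add] at h
  have := Nat.log_mono_right (b := 2) h
  rwa [Nat.log_pow Nat.one_lt_two] at this

/-- **CKRST 2020 §1.3 remark after Thm. 1.8 ("as before … the above theorem holds for polynomials
with coefficients as large as `N`") — Theorem 1.8 in the tree's frame `d = n` for INTEGER
COEFFICIENT BOXES, simple class = the `VNP`-succinct slice `SmallDefinable ℂ n b`.** For every `a₀`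
and `b`, for all large `n`, some `D ∈ Distinguishers ℂ n (a₀+6)` vanishes at the coefficient vector of
every member of `SmallDefinable ℂ n b` whose coefficients are integers of modulus `≤ binom(2n,n)^{a₀}`
and is nonzero at some `{-1,0,1}`-polynomial of degree `≤ n`. (`{-1,0,1}` version in the tree:
`CKRST2020_thm_1_3.frame`.) Via `exists_equation_definableSlice_intBox` (v4 Lemma 3.7's hitting set on
`[2s]^n`, `s = n + n^b + 1`, and v4 Thm. 4.3) and `smallDefinable_subset_definableSlice`.
[cite: ChatterjeeKumarRamyaSaptharishiTengse2020, §1.3, remark after Thm. 1.8 (with Thm. 4.3, Lemma 3.7)] locator: HOME/lit/src/2004.14147/main.tex L300 -/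
theorem intBox_frame_vnp (a₀ b : ℕ) : ∃ n₀ : ℕ, ∀ n ≥ n₀,
    ∃ D : MvPolynomial (degLEMonomials n) ℂ,
      IsNaturalProofRel (degLEMonomials n) (intBoxSlice ℂ n (((2 * n).choose n) ^ a₀))
        (SmallDefinable ℂ n b) (Distinguishers ℂ n (a₀ + 6)) D ∧
      ∃ h ∈ signCoeffSlice ℂ n, h.totalDegree ≤ n ∧
        eval (coeffVector (degLEMonomials n) h) D ≠ 0 := by
  classical
  obtain ⟨e, hmain⟩ := exists_equation_definableSlice_intBox
  set b' := max b 1 with hb'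
  -- constants of the three polynomial thresholds
  set C₁ := 3 ^ e * ((b' + 3) * (e + 1) + 2) + 2 with hC₁
  obtain ⟨n₁, h₁⟩ := eventually_mul_pow_le_choose C₁ (b' * e + 2)
  obtain ⟨n₂, h₂⟩ := eventually_mul_pow_le_choose (2 * (a₀ + 1) + b' + 5) 2
  obtain ⟨n₃, h₃⟩ := eventually_mul_pow_le_choose (C₁ * (b' + 7) + 1) (b' * e + 4)
  obtain ⟨n₄, h₄⟩ := eventually_mul_pow_le_choose 80 0
  refine ⟨max (max n₁ n₂) (max (max n₃ n₄) 2), fun n hn => ?_⟩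
  simp only [ge_iff_le, max_le_iff] at hn
  obtain ⟨⟨hn₁, hn₂⟩, ⟨hn₃, hn₄⟩, hn2⟩ := hn
  have hT1 := h₁ n hn₁
  have hT2 := h₂ n hn₂
  have hT3 := h₃ n hn₃
  have hT80 : 80 ≤ (2 * n).choose n := by simpa using h₄ n hn₄
  set N := (2 * n).choose n with hN
  have hNcard : Nat.card (monomialsDegLE n n) = N := by
    rw [monomialsDegLE_self, GKSS2017.card_degLEMonomials]
  -- the definability parameter `s = n + n^b + 1`
  set s := n + n ^ b + 1 with hs
  have hb'1 : 1 ≤ b' := le_max_right _ _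
  have hnb' : n ≤ n ^ b' := by
    calc n = n ^ 1 := (pow_one n).symm
      _ ≤ n ^ b' := Nat.pow_le_pow_right (by omega) hb'1
  have hbb' : n ^ b ≤ n ^ b' := Nat.pow_le_pow_right (by omega) (le_max_left _ _)
  have h1b' : 1 ≤ n ^ b' := Nat.one_le_pow _ _ (by omega)
  have hs3 : s ≤ 3 * n ^ b' := by omega
  have h2s : 2 * s ≤ 2 ^ (n * b' + 3) := by
    have : n ^ b' ≤ 2 ^ (n * b') := by
      rw [pow_mul]; exact Nat.pow_le_pow_left Nat.lt_two_pow_self.le _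
    calc 2 * s ≤ 8 * n ^ b' := by omega
      _ ≤ 8 * 2 ^ (n * b') := Nat.mul_le_mul_left _ this
      _ = 2 ^ (n * b' + 3) := by ring
  obtain ⟨H, P, hHB, hHcard, hP0, hPL, hPdeg, hPiff, hvan⟩ :=
    hmain n n s (N ^ a₀) (by omega) (by omega) (by omega)
  rw [hNcard] at hPL hPdeg
  have hN1 : 1 ≤ N := by omega
  have hA1 : 1 ≤ N ^ a₀ := Nat.one_le_pow _ _ hN1
  have hNA : 1 ≤ N * N ^ a₀ := Nat.mul_pos (by omega) (by omega)
  have hNA' : N * N ^ a₀ + 1 ≤ 2 * N ^ (a₀ + 1) := by rw [pow_succ']; omega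
  -- `|ℋ| + 1 ≤ C₁ n^{b'e+2} ≤ N`
  have hL1 : Nat.log 2 ((2 * s) ^ n * s ^ e + 1) ≤ (n * b' + 3) * (n + e) + 1 := by
    have hse : s ^ e ≤ (2 * s) ^ e := Nat.pow_le_pow_left (by omega) _
    have h1 : (2 * s) ^ n * s ^ e + 1 ≤ 2 ^ ((n * b' + 3) * (n + e) + 1) := by
      have h2 : (2 * s) ^ n * s ^ e ≤ (2 ^ (n * b' + 3)) ^ (n + e) := by
        calc (2 * s) ^ n * s ^ e ≤ (2 * s) ^ n * (2 * s) ^ e := Nat.mul_le_mul_left _ hse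
          _ = (2 * s) ^ (n + e) := by rw [← pow_add]
          _ ≤ (2 ^ (n * b' + 3)) ^ (n + e) := Nat.pow_le_pow_left h2s _
      rw [← pow_mul] at h2
      have h3 : 1 ≤ 2 ^ ((n * b' + 3) * (n + e)) := Nat.one_le_two_pow
      rw [pow_succ]
      omega
    have := Nat.log_mono_right (b := 2) h1
    rwa [Nat.log_pow Nat.one_lt_two] at this
  have ht' : H.card + 1 ≤ C₁ * n ^ (b' * e + 2) := by
    have hse : s ^ e ≤ 3 ^ e * n ^ (b' * e) := by
      rw [pow_mul, ← mul_pow]; exact Nat.pow_le_pow_left hs3 _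
    have hpoly : (n * b' + 3) * (n + e) + 2 ≤ ((b' + 3) * (e + 1) + 2) * n ^ 2 :=
      arith_poly1 n b' e (by omega)
    calc H.card + 1 ≤ s ^ e * (Nat.log 2 ((2 * s) ^ n * s ^ e + 1) + 1) + 1 + 1 := by omega
      _ ≤ s ^ e * ((n * b' + 3) * (n + e) + 2) + 2 := by
          have := Nat.mul_le_mul_left (s ^ e) (show Nat.log 2 ((2 * s) ^ n * s ^ e + 1) + 1 ≤
            (n * b' + 3) * (n + e) + 2 by omega)
          omega
      _ ≤ (3 ^ e * n ^ (b' * e)) * (((b' + 3) * (e + 1) + 2) * n ^ 2) + 2 :=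
          Nat.add_le_add_right (Nat.mul_le_mul hse hpoly) _
      _ = (3 ^ e * ((b' + 3) * (e + 1) + 2)) * n ^ (b' * e + 2) + 2 := by ring
      _ ≤ C₁ * n ^ (b' * e + 2) := by
          rw [hC₁]
          exact (arith_absorb _ _ (Nat.one_le_pow _ _ (by omega))).1
  have ht : H.card + 1 ≤ N := ht'.trans hT1
  -- `W ≤ (2(a₀+1) + b' + 5) n² ≤ N`
  have hW : Nat.log 2 (N * N ^ a₀ * (2 * s) ^ n) + 2 ≤ N := by
    refine le_trans ?_ hT2
    have h := log_two_mul_pow_le n a₀ (n * b' + 3) (2 * s) h2s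
    rw [← hN] at h
    have := arith_poly2 n a₀ b' (by omega)
    omega
  -- (1) membership in `Distinguishers ℂ n (a₀ + 6)`
  have hsize : complexity P ≤ N ^ (a₀ + 6) := by
    refine hPL.trans ?_
    calc 20 * (H.card + 1) * (N * N ^ a₀ + 1) * (N + 1) * (Nat.log 2 (N * N ^ a₀ * (2 * s) ^ n) + 2) ^ 2
        ≤ 20 * N * (2 * N ^ (a₀ + 1)) * (2 * N) * N ^ 2 := by
          gcongr
          · omega
      _ = 80 * N ^ (a₀ + 5) := by ring
      _ ≤ N * N ^ (a₀ + 5) := Nat.mul_le_mul_right _ hT80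
      _ = N ^ (a₀ + 6) := by ring
  have hdegP : P.totalDegree ≤ N ^ (a₀ + 6) := by
    refine hPdeg.trans ?_
    calc 10 * (H.card + 1) * (N * N ^ a₀ + 1) * (Nat.log 2 (N * N ^ a₀ * (2 * s) ^ n) + 2) ^ 2
        ≤ 10 * N * (2 * N ^ (a₀ + 1)) * N ^ 2 := by gcongr
      _ = 20 * N ^ (a₀ + 4) := by ring
      _ ≤ N * N ^ (a₀ + 4) := Nat.mul_le_mul_right _ (by omega)
      _ = N ^ (a₀ + 5) := by ring
      _ ≤ N ^ (a₀ + 6) := Nat.pow_le_pow_right hN1 (by omega)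
  -- (2) the `{-1,0,1}` witness vanishing on `ℋ`
  have hHabs : ∀ a ∈ H, ∀ j, |a j| ≤ ((2 * s : ℕ) : ℤ) := by
    intro a ha j
    obtain ⟨h1, h2⟩ := hHB a ha j
    rw [abs_le]; constructor <;> linarith
  have hB1 : 1 ≤ 2 * s := by omega
  have hcount : (2 * (Nat.card (monomialsDegLE n n) * (2 * s) ^ n) + 1) ^ H.card <
      2 ^ Nat.card (monomialsDegLE n n) := by
    rw [hNcard]
    have hE : 2 * (N * (2 * s) ^ n) + 1 ≤ 2 ^ (2 * n * 1 + n * (n * b' + 3) + 2) := by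
      have h0 := log_two_mul_pow_le n 0 (n * b' + 3) (2 * s) h2s
      rw [pow_zero, mul_one, ← hN] at h0
      have hlt := Nat.lt_pow_succ_log_self Nat.one_lt_two (N * (2 * s) ^ n)
      have hmono : 2 ^ (Nat.log 2 (N * (2 * s) ^ n) + 1) ≤
          2 ^ (2 * n * (0 + 1) + n * (n * b' + 3) + 1) :=
        Nat.pow_le_pow_right (by norm_num) (by omega)
      have : 2 ^ (2 * n * 1 + n * (n * b' + 3) + 2) =
          2 * 2 ^ (2 * n * (0 + 1) + n * (n * b' + 3) + 1) := by ring
      rw [this]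
      omega
    have hexp : H.card * (2 * n * 1 + n * (n * b' + 3) + 2) < N := by
      have hc : H.card ≤ C₁ * n ^ (b' * e + 2) := by omega
      have h6 : 2 * n * 1 + n * (n * b' + 3) + 2 ≤ (b' + 7) * n ^ 2 := by
        calc 2 * n * 1 + n * (n * b' + 3) + 2 ≤ (2 * (0 + 1) + b' + 5) * n ^ 2 :=
              arith_poly2 n 0 b' (by omega)
          _ = (b' + 7) * n ^ 2 := by ring
      calc H.card * (2 * n * 1 + n * (n * b' + 3) + 2)
          ≤ (C₁ * n ^ (b' * e + 2)) * ((b' + 7) * n ^ 2) := Nat.mul_le_mul hc h6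
        _ = C₁ * (b' + 7) * n ^ (b' * e + 4) := by ring
        _ < (C₁ * (b' + 7) + 1) * n ^ (b' * e + 4) :=
            (arith_absorb _ _ (Nat.one_le_pow _ _ (by omega))).2
        _ ≤ N := hT3
    calc (2 * (N * (2 * s) ^ n) + 1) ^ H.card
        ≤ (2 ^ (2 * n * 1 + n * (n * b' + 3) + 2)) ^ H.card := Nat.pow_le_pow_left hE _
      _ = 2 ^ (H.card * (2 * n * 1 + n * (n * b' + 3) + 2)) := by rw [← pow_mul, mul_comm]
      _ < 2 ^ N := Nat.pow_lt_pow_right (by norm_num) hexp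
  obtain ⟨g, hg0, hgd, hgs, hgv⟩ :=
    exists_signCoeff_vanishing_on ℂ n n (2 * s) hB1 H hHabs hcount
  have hgbox : g ∈ intBoxSlice ℂ n (N ^ a₀) := signCoeffSlice_subset_intBoxSlice ℂ hA1 hgs
  have hgP : eval (coeffVector (degLEMonomials n) g) P ≠ 0 := by
    intro h0
    obtain ⟨a, ha, hne⟩ := (hPiff g hgd hgbox).mp h0 hg0
    exact hne (hgv a ha)
  -- (3) assemble
  refine ⟨P, ⟨⟨hsize, hdegP⟩, ⟨g, hgbox, hgP⟩, fun f hf hfbox => ?_⟩, g, hgs, hgd, hgP⟩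
  exact hvan f (smallDefinable_subset_definableSlice n b hf) hfbox

/-- Consequence (the box version of `CKRST2020_thm_1_3.not_isSuccinctHittingSetRel`): at
distinguisher level `a₀ + 6`, for every `b`, eventually the members of the `VNP` slice
`SmallDefinable ℂ n b` with integer coefficients of modulus `≤ binom(2n,n)^{a₀}` FAIL to hit.
[cite: ChatterjeeKumarRamyaSaptharishiTengse2020, §1.3, remark after Thm. 1.8] locator: HOME/lit/src/2004.14147/main.tex L300 -/
theorem not_isSuccinctHittingSetRel_intBox_vnp (a₀ b : ℕ) : ∃ n₀ : ℕ, ∀ n ≥ n₀,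
    ¬ IsSuccinctHittingSetRel (degLEMonomials n) (intBoxSlice ℂ n (((2 * n).choose n) ^ a₀))
        (SmallDefinable ℂ n b) (Distinguishers ℂ n (a₀ + 6)) := by
  obtain ⟨n₀, h⟩ := intBox_frame_vnp a₀ b
  refine ⟨n₀, fun n hn => ?_⟩
  obtain ⟨D, hD, -⟩ := h n hn
  exact (exists_isNaturalProofRel_iff _ _ _ _).1 ⟨D, hD⟩

/-! ### One family for every size exponent: the schedule `s(n) = n^{⌊log₂ n⌋ + 1}` (print: "`s_n`
can be any function that is barely super-polynomial in `n`", proof of Thm. 1.6) -/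

/-- `2^{e(L+1)² + 3L + 8} ≤ 2^{2^L}`-type threshold in the exponent: for all large `L`,
`(e+3)(L+1)² + 8 ≤ 2^L`. [folklore] -/
private theorem eventually_quad_le_two_pow (e : ℕ) : ∃ L₀ : ℕ, ∀ L ≥ L₀, (e + 3) * (L + 1) ^ 2 + 8 ≤ 2 ^ L := by
  obtain ⟨L₀, h⟩ := eventually_mul_pow_le_two_pow (4 * (e + 3) + 8) 2
  refine ⟨max L₀ 1, fun L hL => ?_⟩
  have hL1 : 1 ≤ L := le_trans (le_max_right _ _) hL
  have h1 := h L (le_trans (le_max_left _ _) hL)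
  have h2 : (L + 1) ^ 2 ≤ 4 * L ^ 2 := by nlinarith
  have h3 : 8 ≤ 8 * L ^ 2 := by nlinarith
  nlinarith

/-- The thresholds for the uniform schedule, with `L = ⌊log₂ n⌋`, `s = n^{L+1}`, `N = binom(2n,n)`:
for fixed `a, e, b` and all large `n`. [folklore] -/
private theorem uniform_thresholds (a e b : ℕ) : ∃ n₀ : ℕ, ∀ n ≥ n₀,
    2 ≤ n ∧ n ^ b ≤ n ^ (Nat.log 2 n + 1) ∧
    (n ^ (Nat.log 2 n + 1)) ^ e + 1 ≤ (2 * n).choose n ∧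
    2 * n * (a + 1) + n * (2 * (Nat.log 2 n + 1) * (Nat.log 2 n + 2)) + 2 ≤ (2 * n).choose n ∧
    (n ^ (Nat.log 2 n + 1)) ^ e * (2 * n * 1 + n * (2 * (Nat.log 2 n + 1) * (Nat.log 2 n + 2)) + 2) <
      (2 * n).choose n ∧
    80 ≤ (2 * n).choose n := by
  obtain ⟨L₀, hL₀⟩ := eventually_quad_le_two_pow e
  obtain ⟨n₂, h₂⟩ := eventually_mul_pow_le_choose (2 * (a + 1) + 14) 3
  obtain ⟨n₄, h₄⟩ := eventually_mul_pow_le_choose 80 0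
  refine ⟨max (max (2 ^ L₀) (2 ^ b)) (max (max n₂ n₄) 2), fun n hn => ?_⟩
  simp only [ge_iff_le, max_le_iff] at hn
  obtain ⟨⟨hnL₀, hnb⟩, ⟨hn₂, hn₄⟩, hn2⟩ := hn
  set L := Nat.log 2 n with hL
  have hn0 : n ≠ 0 := by omega
  have hLn : 2 ^ L ≤ n := by rw [hL]; exact Nat.pow_log_le_self 2 hn0
  have hnL : n < 2 ^ (L + 1) := by rw [hL]; exact Nat.lt_pow_succ_log_self Nat.one_lt_two n
  have hL₀L : L₀ ≤ L := by
    rw [hL]; exact Nat.le_log_of_pow_le Nat.one_lt_two hnL₀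
  have hbL : b ≤ L := by
    rw [hL]; exact Nat.le_log_of_pow_le Nat.one_lt_two hnb
  have hLle : L ≤ n := by rw [hL]; exact (Nat.log_lt_self 2 hn0).le
  have hkey := hL₀ L hL₀L   -- (e+3)(L+1)² + 8 ≤ 2^L ≤ n
  have hN := two_pow_le_centralBinom' n   -- 2^n ≤ N
  -- `s^e ≤ 2^{(L+1)² e}`
  have hnL' : n ≤ 2 ^ (L + 1) := hnL.le
  have hs : (n ^ (L + 1)) ^ e ≤ 2 ^ ((L + 1) ^ 2 * e) := by
    calc (n ^ (L + 1)) ^ e ≤ ((2 ^ (L + 1)) ^ (L + 1)) ^ e :=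
          Nat.pow_le_pow_left (Nat.pow_le_pow_left hnL' _) _
      _ = 2 ^ ((L + 1) ^ 2 * e) := by rw [← pow_mul, ← pow_mul]; ring_nf
  have hn1 : 1 ≤ n := by omega
  have hn3a : n ^ 2 ≤ n ^ 3 := Nat.pow_le_pow_right hn1 (by norm_num)
  have hn3b : n ≤ n ^ 3 := by
    calc n = n ^ 1 := (pow_one n).symm
      _ ≤ n ^ 3 := Nat.pow_le_pow_right hn1 (by norm_num)
  have hk : 2 * (L + 1) * (L + 2) ≤ 2 * (n + 1) * (n + 2) :=
    Nat.mul_le_mul (Nat.mul_le_mul_left _ (by omega)) (by omega)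
  have hnk : n * (2 * (L + 1) * (L + 2)) ≤ 12 * n ^ 3 := by
    refine (Nat.mul_le_mul_left _ hk).trans ?_
    have e1 : n * (2 * (n + 1) * (n + 2)) = 2 * n ^ 3 + 6 * n ^ 2 + 4 * n := by ring
    rw [e1]; omega
  have hse1 : 1 ≤ (n ^ (L + 1)) ^ e := Nat.one_le_pow _ _ (Nat.one_le_pow _ _ (by omega))
  refine ⟨hn2, Nat.pow_le_pow_right (by omega) (by omega), ?_, ?_, ?_, by simpa using h₄ n hn₄⟩
  · -- `s^e + 1 ≤ 2^{(L+1)²e + 1} ≤ 2^n ≤ N`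
    have h1 : (n ^ (L + 1)) ^ e + 1 ≤ 2 ^ ((L + 1) ^ 2 * e + 1) := by
      have e2 : 2 ^ ((L + 1) ^ 2 * e + 1) = 2 * 2 ^ ((L + 1) ^ 2 * e) := by ring
      rw [e2]; omega
    have h2 : 2 ^ ((L + 1) ^ 2 * e + 1) ≤ 2 ^ n :=
      Nat.pow_le_pow_right (by norm_num) (by nlinarith)
    exact h1.trans (h2.trans hN)
  · -- `W`-type bound: `≤ (2(a+1)+14) n³ ≤ N`
    refine le_trans ?_ (h₂ n hn₂)
    have h4 : 2 * n * (a + 1) ≤ 2 * (a + 1) * n ^ 3 := by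
      calc 2 * n * (a + 1) = 2 * (a + 1) * n := by ring
        _ ≤ 2 * (a + 1) * n ^ 3 := Nat.mul_le_mul_left _ hn3b
    have h5 : 2 ≤ 2 * n ^ 3 := by omega
    calc 2 * n * (a + 1) + n * (2 * (L + 1) * (L + 2)) + 2
        ≤ 2 * (a + 1) * n ^ 3 + 12 * n ^ 3 + 2 * n ^ 3 := Nat.add_le_add (Nat.add_le_add h4 hnk) h5
      _ = (2 * (a + 1) + 14) * n ^ 3 := by ring
  · -- witness exponent: `s^e · (2n + nk + 2) ≤ 2^{(L+1)²e} · 2^{3L+7} < 2^n ≤ N`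
    have hE : 2 * n * 1 + n * (2 * (L + 1) * (L + 2)) + 2 ≤ 16 * n ^ 3 := by omega
    have hE2 : 16 * n ^ 3 ≤ 2 ^ (3 * L + 7) := by
      calc 16 * n ^ 3 ≤ 16 * (2 ^ (L + 1)) ^ 3 := by gcongr
        _ = 2 ^ (3 * L + 7) := by rw [← pow_mul]; ring
    have hexp : (L + 1) ^ 2 * e + (3 * L + 7) + 1 ≤ n := by
      have hL2 : L ≤ (L + 1) ^ 2 := by nlinarith
      nlinarith
    calc (n ^ (L + 1)) ^ e * (2 * n * 1 + n * (2 * (L + 1) * (L + 2)) + 2)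
        ≤ 2 ^ ((L + 1) ^ 2 * e) * 2 ^ (3 * L + 7) := Nat.mul_le_mul hs (hE.trans hE2)
      _ = 2 ^ ((L + 1) ^ 2 * e + (3 * L + 7)) := by rw [← pow_add]
      _ < 2 ^ ((L + 1) ^ 2 * e + (3 * L + 7) + 1) := Nat.pow_lt_pow_right (by norm_num) (by omega)
      _ ≤ 2 ^ n := Nat.pow_le_pow_right (by norm_num) hexp
      _ ≤ (2 * n).choose n := hN

/-- **Theorem 1.6 for the box `[-N^{a₀}, N^{a₀}]`, ONE family for every size exponent** (the shape of
`CKRST2020_thm_1_1.frame`): there is `D_n ∈ Distinguishers ℂ n (a₀+6)` such that for EVERY `b`, for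
all large `n`, `D_n` vanishes at the coefficient vector of every member of `SmallCircuits ℂ n b` with
integer coefficients of modulus `≤ binom(2n,n)^{a₀}` and is nonzero at some `{-1,0,1}`-polynomial of
degree `≤ n`. The family is the equation of `exists_equation_vpSlice_intBox` for the class
`𝒞(n, n, s(n))` with the barely super-polynomial schedule `s(n) = n^{⌊log₂ n⌋+1}` (print, proof of
Thm. 1.6: "`s_n = n^{log n}` (in fact, `s_n` can be any function that is barely super-polynomial in
`n`)"), which dominates every `n^b` once `n ≥ 2^b`.
[cite: ChatterjeeKumarRamyaSaptharishiTengse2020, Thm. 1.6 (proof) with the §1.3 remark after it] locator: HOME/lit/src/2004.14147/main.tex L258, L1396–L1411 -/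
theorem intBox_frame_uniform (a₀ : ℕ) : ∃ D : (n : ℕ) → MvPolynomial (degLEMonomials n) ℂ,
    ∀ b : ℕ, ∃ n₀ : ℕ, ∀ n ≥ n₀,
      IsNaturalProofRel (degLEMonomials n) (intBoxSlice ℂ n (((2 * n).choose n) ^ a₀))
        (SmallCircuits ℂ n b) (Distinguishers ℂ n (a₀ + 6)) (D n) ∧
      ∃ h ∈ signCoeffSlice ℂ n, h.totalDegree ≤ n ∧
        eval (coeffVector (degLEMonomials n) h) (D n) ≠ 0 := by
  classical
  obtain ⟨e, hmain⟩ := exists_equation_vpSlice_intBox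
  -- the family: for `n ≥ 2` the equation for `𝒞(n,n,n^{L+1}) ∩ [-N^{a₀}, N^{a₀}]`
  have key : ∀ n : ℕ, ∃ (H : Finset (Fin n → ℤ)) (P : MvPolynomial (monomialsDegLE n n) ℂ), 2 ≤ n →
      (∀ a ∈ H, ∀ i, 1 ≤ a i ∧ a i ≤ ((n ^ (Nat.log 2 n + 1) * n) ^ 2 : ℕ)) ∧
      H.card ≤ (n ^ (Nat.log 2 n + 1)) ^ e ∧ P ≠ 0 ∧
      complexity P ≤ 20 * ((n ^ (Nat.log 2 n + 1)) ^ e + 1) *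
          (Nat.card (monomialsDegLE n n) * ((2 * n).choose n) ^ a₀ + 1) *
          (Nat.card (monomialsDegLE n n) + 1) *
          (Nat.log 2 (Nat.card (monomialsDegLE n n) * ((2 * n).choose n) ^ a₀ *
            ((n ^ (Nat.log 2 n + 1) * n) ^ 2) ^ n) + 2) ^ 2 ∧
      P.totalDegree ≤ 10 * ((n ^ (Nat.log 2 n + 1)) ^ e + 1) *
          (Nat.card (monomialsDegLE n n) * ((2 * n).choose n) ^ a₀ + 1) *
          (Nat.log 2 (Nat.card (monomialsDegLE n n) * ((2 * n).choose n) ^ a₀ *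
            ((n ^ (Nat.log 2 n + 1) * n) ^ 2) ^ n) + 2) ^ 2 ∧
      (∀ f : MvPolynomial (Fin n) ℂ, f.totalDegree ≤ n →
        (∀ m, ∃ z : ℤ, coeff m f = (z : ℂ) ∧ |z| ≤ (((2 * n).choose n) ^ a₀ : ℕ)) →
        (eval (coeffVector (monomialsDegLE n n) f) P = 0 ↔
          (f ≠ 0 → ∃ a ∈ H, eval (fun j => ((a j : ℤ) : ℂ)) f ≠ 0))) ∧
      (∀ f ∈ vpSlice ℂ n n (n ^ (Nat.log 2 n + 1)),
        (∀ m, ∃ z : ℤ, coeff m f = (z : ℂ) ∧ |z| ≤ (((2 * n).choose n) ^ a₀ : ℕ)) →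
        eval (coeffVector (monomialsDegLE n n) f) P = 0) := by
    intro n
    by_cases hn : 2 ≤ n
    · have hns : n ≤ n ^ (Nat.log 2 n + 1) := by
        calc n = n ^ 1 := (pow_one n).symm
          _ ≤ n ^ (Nat.log 2 n + 1) := Nat.pow_le_pow_right (by omega) (by omega)
      obtain ⟨H, P, h⟩ := hmain n n (n ^ (Nat.log 2 n + 1)) (((2 * n).choose n) ^ a₀)
        (by omega) hns (by omega) hns (le_trans hn hns)
      exact ⟨H, P, fun _ => h⟩
    · exact ⟨∅, 0, fun h => absurd h hn⟩
  choose H P hHP using key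
  refine ⟨fun n => P n, fun b => ?_⟩
  obtain ⟨n₀, hthr⟩ := uniform_thresholds a₀ e b
  refine ⟨n₀, fun n hn => ?_⟩
  obtain ⟨hn2, hbs, hT1, hT2, hT3, hT80⟩ := hthr n hn
  obtain ⟨hHB, hHcard, hP0, hPL, hPdeg, hPiff, hvan⟩ := hHP n hn2
  set L := Nat.log 2 n with hL
  set N := (2 * n).choose n with hN
  have hNcard : Nat.card (monomialsDegLE n n) = N := by
    rw [monomialsDegLE_self, GKSS2017.card_degLEMonomials]
  rw [hNcard] at hPL hPdeg
  set s := n ^ (L + 1) with hs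
  have hN1 : 1 ≤ N := by omega
  have hA1 : 1 ≤ N ^ a₀ := Nat.one_le_pow _ _ hN1
  have hNA : 1 ≤ N * N ^ a₀ := Nat.mul_pos (by omega) (by omega)
  have hNA' : N * N ^ a₀ + 1 ≤ 2 * N ^ (a₀ + 1) := by rw [pow_succ']; omega
  have h2X : (s * n) ^ 2 ≤ 2 ^ (2 * (L + 1) * (L + 2)) := by
    have hnL : n ≤ 2 ^ (L + 1) := (Nat.lt_pow_succ_log_self Nat.one_lt_two n).le
    calc (s * n) ^ 2 = (n ^ (L + 2)) ^ 2 := by rw [hs]; ring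
      _ ≤ ((2 ^ (L + 1)) ^ (L + 2)) ^ 2 := by gcongr
      _ = 2 ^ (2 * (L + 1) * (L + 2)) := by rw [← pow_mul, ← pow_mul]; ring_nf
  have hW : Nat.log 2 (N * N ^ a₀ * ((s * n) ^ 2) ^ n) + 2 ≤ N := by
    refine le_trans ?_ hT2
    have h := log_two_mul_pow_le n a₀ (2 * (L + 1) * (L + 2)) ((s * n) ^ 2) h2X
    rw [← hN] at h
    omega
  -- (1) membership in `Distinguishers ℂ n (a₀ + 6)`
  have hsize : complexity (P n) ≤ N ^ (a₀ + 6) := by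
    refine hPL.trans ?_
    calc 20 * (s ^ e + 1) * (N * N ^ a₀ + 1) * (N + 1) * (Nat.log 2 (N * N ^ a₀ * ((s * n) ^ 2) ^ n) + 2) ^ 2
        ≤ 20 * N * (2 * N ^ (a₀ + 1)) * (2 * N) * N ^ 2 := by
          gcongr
          · omega
      _ = 80 * N ^ (a₀ + 5) := by ring
      _ ≤ N * N ^ (a₀ + 5) := Nat.mul_le_mul_right _ hT80
      _ = N ^ (a₀ + 6) := by ring
  have hdegP : (P n).totalDegree ≤ N ^ (a₀ + 6) := by
    refine hPdeg.trans ?_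
    calc 10 * (s ^ e + 1) * (N * N ^ a₀ + 1) * (Nat.log 2 (N * N ^ a₀ * ((s * n) ^ 2) ^ n) + 2) ^ 2
        ≤ 10 * N * (2 * N ^ (a₀ + 1)) * N ^ 2 := by gcongr
      _ = 20 * N ^ (a₀ + 4) := by ring
      _ ≤ N * N ^ (a₀ + 4) := Nat.mul_le_mul_right _ (by omega)
      _ = N ^ (a₀ + 5) := by ring
      _ ≤ N ^ (a₀ + 6) := Nat.pow_le_pow_right hN1 (by omega)
  -- (2) the `{-1,0,1}` witness vanishing on `ℋ_n`
  have hHabs : ∀ a ∈ H n, ∀ j, |a j| ≤ (((s * n) ^ 2 : ℕ) : ℤ) := by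
    intro a ha j
    obtain ⟨h1, h2⟩ := hHB a ha j
    rw [abs_le]; constructor <;> linarith
  have hB1 : 1 ≤ (s * n) ^ 2 :=
    Nat.one_le_pow _ _ (Nat.mul_pos (Nat.one_le_pow _ _ (by omega)) (by omega))
  have hcount : (2 * (Nat.card (monomialsDegLE n n) * ((s * n) ^ 2) ^ n) + 1) ^ (H n).card <
      2 ^ Nat.card (monomialsDegLE n n) := by
    rw [hNcard]
    have hE : 2 * (N * ((s * n) ^ 2) ^ n) + 1 ≤ 2 ^ (2 * n * 1 + n * (2 * (L + 1) * (L + 2)) + 2) := by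
      have h0 := log_two_mul_pow_le n 0 (2 * (L + 1) * (L + 2)) ((s * n) ^ 2) h2X
      rw [pow_zero, mul_one, ← hN] at h0
      have hlt := Nat.lt_pow_succ_log_self Nat.one_lt_two (N * ((s * n) ^ 2) ^ n)
      have hmono : 2 ^ (Nat.log 2 (N * ((s * n) ^ 2) ^ n) + 1) ≤
          2 ^ (2 * n * (0 + 1) + n * (2 * (L + 1) * (L + 2)) + 1) :=
        Nat.pow_le_pow_right (by norm_num) (by omega)
      have : 2 ^ (2 * n * 1 + n * (2 * (L + 1) * (L + 2)) + 2) =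
          2 * 2 ^ (2 * n * (0 + 1) + n * (2 * (L + 1) * (L + 2)) + 1) := by ring
      rw [this]
      omega
    have hexp : (H n).card * (2 * n * 1 + n * (2 * (L + 1) * (L + 2)) + 2) < N :=
      lt_of_le_of_lt (Nat.mul_le_mul_right _ hHcard) hT3
    calc (2 * (N * ((s * n) ^ 2) ^ n) + 1) ^ (H n).card
        ≤ (2 ^ (2 * n * 1 + n * (2 * (L + 1) * (L + 2)) + 2)) ^ (H n).card := Nat.pow_le_pow_left hE _
      _ = 2 ^ ((H n).card * (2 * n * 1 + n * (2 * (L + 1) * (L + 2)) + 2)) := by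
          rw [← pow_mul, mul_comm]
      _ < 2 ^ N := Nat.pow_lt_pow_right (by norm_num) hexp
  obtain ⟨g, hg0, hgd, hgs, hgv⟩ :=
    exists_signCoeff_vanishing_on ℂ n n ((s * n) ^ 2) hB1 (H n) hHabs hcount
  have hgbox : g ∈ intBoxSlice ℂ n (N ^ a₀) := signCoeffSlice_subset_intBoxSlice ℂ hA1 hgs
  have hgP : eval (coeffVector (degLEMonomials n) g) (P n) ≠ 0 := by
    intro h0
    obtain ⟨a, ha, hne⟩ := (hPiff g hgd hgbox).mp h0 hg0
    exact hne (hgv a ha)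
  -- (3) assemble: `SmallCircuits ℂ n b ⊆ 𝒞(n, n, s)` since `n^b ≤ s`
  refine ⟨⟨⟨hsize, hdegP⟩, ⟨g, hgbox, hgP⟩, fun f hf hfbox => ?_⟩, g, hgs, hgd, hgP⟩
  exact hvan f ⟨hf.1, hf.2.trans hbs⟩ hfbox

/-- The `∃ a D, ∀ b` packaging of `intBox_frame_uniform` (the exact shape of
`CKRST2020_thm_1_1.frame`, with `signCoeffSlice` replaced by the box of magnitude `binom(2n,n)^{a₀}`).
[cite: ChatterjeeKumarRamyaSaptharishiTengse2020, Thm. 1.6 with the §1.3 remark after it] -/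
theorem intBox_frame' (a₀ : ℕ) :
    ∃ (a : ℕ) (D : (n : ℕ) → MvPolynomial (degLEMonomials n) ℂ), ∀ b : ℕ, ∃ n₀ : ℕ, ∀ n ≥ n₀,
      IsNaturalProofRel (degLEMonomials n) (intBoxSlice ℂ n (((2 * n).choose n) ^ a₀))
          (SmallCircuits ℂ n b) (Distinguishers ℂ n a) (D n) ∧
        ∃ h ∈ signCoeffSlice ℂ n, h.totalDegree ≤ n ∧
          eval (coeffVector (degLEMonomials n) h) (D n) ≠ 0 :=
  ⟨a₀ + 6, intBox_frame_uniform a₀⟩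

/-! ### Theorem 1.6 AS PRINTED (degree `n^c`, `N = binom(n + n^c, n)`) for the box
`[-N^{a₀}, N^{a₀}]` — the literal reading of the §1.3 remark -/

/-- `log₂ (N · N^a · X^d) ≤ u(a+1) + d k` when `N ≤ 2^u` and `X ≤ 2^k`. [folklore] -/
private theorem log_two_le_of_bounds (N a X d u k : ℕ) (hN : N ≤ 2 ^ u) (hX : X ≤ 2 ^ k) :
    Nat.log 2 (N * N ^ a * X ^ d) ≤ u * (a + 1) + d * k := by
  have h1 : N * N ^ a ≤ 2 ^ (u * (a + 1)) := by
    rw [← pow_succ', pow_mul]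
    exact Nat.pow_le_pow_left hN _
  have h2 : X ^ d ≤ 2 ^ (d * k) := by
    rw [mul_comm, pow_mul]; exact Nat.pow_le_pow_left hX _
  have h := Nat.mul_le_mul h1 h2
  rw [← pow_add] at h
  have := Nat.log_mono_right (b := 2) h
  rwa [Nat.log_pow Nat.one_lt_two] at this

/-- For all large `L`: `A (L+1)² + B ≤ 2^L`. [folklore] -/
private theorem eventually_quad_le_two_pow' (A B : ℕ) :
    ∃ L₀ : ℕ, ∀ L ≥ L₀, A * (L + 1) ^ 2 + B ≤ 2 ^ L := by
  obtain ⟨L₀, h⟩ := eventually_mul_pow_le_two_pow (4 * A + B) 2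
  refine ⟨max L₀ 1, fun L hL => ?_⟩
  have hL1 : 1 ≤ L := le_trans (le_max_right _ _) hL
  have h1 := h L (le_trans (le_max_left _ _) hL)
  have h2 : (L + 1) ^ 2 ≤ 4 * L ^ 2 := by nlinarith
  have h3 : A * (L + 1) ^ 2 ≤ A * (4 * L ^ 2) := Nat.mul_le_mul_left _ h2
  have h4 : B ≤ B * L ^ 2 := Nat.le_mul_of_pos_right _ (by positivity)
  have e1 : (4 * A + B) * L ^ 2 = A * (4 * L ^ 2) + B * L ^ 2 := by ring
  omega

/-- Arithmetic: `n + n^c ≤ 2 n^{c+2}` (`n ≥ 1`). [folklore] -/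
private theorem gt_sum_le (n c : ℕ) (hn1 : 1 ≤ n) : n + n ^ c ≤ 2 * n ^ (c + 2) := by
  have h1 : n ≤ n ^ (c + 2) := by
    calc n = n ^ 1 := (pow_one n).symm
      _ ≤ n ^ (c + 2) := Nat.pow_le_pow_right hn1 (by omega)
  have h2 : n ^ c ≤ n ^ (c + 2) := Nat.pow_le_pow_right hn1 (by omega)
  omega

/-- Arithmetic: `2(L+1)(L+1+c) ≤ 4(c+2) n²` (`L ≤ n`, `n ≥ 1`). [folklore] -/
private theorem gt_quad_le (n c L : ℕ) (hLn : L ≤ n) (hn1 : 1 ≤ n) :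
    2 * (L + 1) * (L + 1 + c) ≤ 4 * (c + 2) * n ^ 2 := by
  have h1 : L + 1 ≤ 2 * n := by omega
  have h2 : L + 1 + c ≤ (c + 2) * n := by
    have hc : c ≤ c * n := Nat.le_mul_of_pos_right c hn1
    have e1 : (c + 2) * n = c * n + 2 * n := by ring
    omega
  calc 2 * (L + 1) * (L + 1 + c) ≤ 2 * (2 * n) * ((c + 2) * n) :=
        Nat.mul_le_mul (Nat.mul_le_mul_left _ h1) h2
    _ = 4 * (c + 2) * n ^ 2 := by ring

/-- Arithmetic: `(n + n^c)(a+1) + n^c · 2(L+1)(L+1+c) + 2 ≤ (2(a+1) + 4(c+2) + 2) n^{c+2}`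
(`L ≤ n`, `n ≥ 1`). [folklore] -/
private theorem gt_poly_le (n a c L : ℕ) (hLn : L ≤ n) (hn1 : 1 ≤ n) :
    (n + n ^ c) * (a + 1) + n ^ c * (2 * (L + 1) * (L + 1 + c)) + 2 ≤
      (2 * (a + 1) + 4 * (c + 2) + 2) * n ^ (c + 2) := by
  have h1 : (n + n ^ c) * (a + 1) ≤ 2 * n ^ (c + 2) * (a + 1) :=
    Nat.mul_le_mul_right _ (gt_sum_le n c hn1)
  have h2 : n ^ c * (2 * (L + 1) * (L + 1 + c)) ≤ n ^ c * (4 * (c + 2) * n ^ 2) :=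
    Nat.mul_le_mul_left _ (gt_quad_le n c L hLn hn1)
  have h3 : 1 ≤ n ^ (c + 2) := Nat.one_le_pow _ _ hn1
  calc (n + n ^ c) * (a + 1) + n ^ c * (2 * (L + 1) * (L + 1 + c)) + 2
      ≤ 2 * n ^ (c + 2) * (a + 1) + n ^ c * (4 * (c + 2) * n ^ 2) + 2 * n ^ (c + 2) :=
        Nat.add_le_add (Nat.add_le_add h1 h2) (by omega)
    _ = (2 * (a + 1) + 4 * (c + 2) + 2) * n ^ (c + 2) := by ring

/-- Arithmetic: the witness exponent is dominated by the key inequality. [folklore] -/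
private theorem gt_exp_le (L c e X : ℕ)
    (hkey : (e + 4 * (c + 2) + 8) * (L + 1) ^ 2 + (4 * (c + 2) + 16) ≤ X) :
    (L + 1) ^ 2 * e + ((c + 2) * (L + 1) + (4 * (c + 2) + 4)) + 2 ≤ X := by
  have h1 : (c + 2) * (L + 1) ≤ (c + 2) * (L + 1) ^ 2 :=
    Nat.mul_le_mul_left _ (Nat.le_self_pow two_ne_zero _)
  have h2 : (e + 4 * (c + 2) + 8) * (L + 1) ^ 2 =
      (L + 1) ^ 2 * e + 4 * ((c + 2) * (L + 1) ^ 2) + 8 * (L + 1) ^ 2 := by ring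
  omega

/-- The thresholds for degree `d = n^c` (`c ≥ 1`) with the schedule `s = n^{L+1}`, `L = ⌊log₂ n⌋`,
`N = binom(n + n^c, n) ≥ 2^n`: for fixed `a, c, e` and all large `n`. [folklore] -/
private theorem general_thresholds (a c e : ℕ) (hc : 1 ≤ c) : ∃ n₀ : ℕ, ∀ n ≥ n₀,
    2 ≤ n ∧ n ^ c ≤ n ^ (Nat.log 2 n + 1) ∧
    (n ^ (Nat.log 2 n + 1)) ^ e + 1 ≤ (n + n ^ c).choose n ∧
    (n + n ^ c) * (a + 1) + n ^ c * (2 * (Nat.log 2 n + 1) * (Nat.log 2 n + 1 + c)) + 2 ≤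
      (n + n ^ c).choose n ∧
    (n ^ (Nat.log 2 n + 1)) ^ e *
        ((n + n ^ c) * (0 + 1) + n ^ c * (2 * (Nat.log 2 n + 1) * (Nat.log 2 n + 1 + c)) + 2) <
      (n + n ^ c).choose n ∧
    80 ≤ (n + n ^ c).choose n := by
  obtain ⟨L₀, hL₀⟩ := eventually_quad_le_two_pow' (e + 4 * (c + 2) + 8) (4 * (c + 2) + 16)
  obtain ⟨n₂, h₂⟩ := eventually_mul_pow_le_two_pow (2 * (a + 1) + 4 * (c + 2) + 2) (c + 2)
  obtain ⟨n₄, h₄⟩ := eventually_mul_pow_le_two_pow 80 0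
  refine ⟨max (max (2 ^ L₀) (2 ^ c)) (max (max n₂ n₄) 2), fun n hn => ?_⟩
  simp only [ge_iff_le, max_le_iff] at hn
  obtain ⟨⟨hnL₀, hnc⟩, ⟨hn₂, hn₄⟩, hn2⟩ := hn
  set L := Nat.log 2 n with hL
  have hn0 : n ≠ 0 := by omega
  have hn1 : 1 ≤ n := by omega
  have hLn : 2 ^ L ≤ n := by rw [hL]; exact Nat.pow_log_le_self 2 hn0
  have hnL : n < 2 ^ (L + 1) := by rw [hL]; exact Nat.lt_pow_succ_log_self Nat.one_lt_two n
  have hnL' : n ≤ 2 ^ (L + 1) := hnL.le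
  have hL₀L : L₀ ≤ L := by rw [hL]; exact Nat.le_log_of_pow_le Nat.one_lt_two hnL₀
  have hcL : c ≤ L := by rw [hL]; exact Nat.le_log_of_pow_le Nat.one_lt_two hnc
  have hLle : L ≤ n := by rw [hL]; exact (Nat.log_lt_self 2 hn0).le
  have hkey := gt_exp_le L c e n ((hL₀ L hL₀L).trans hLn)
  -- `2^n ≤ binom(2n, n) ≤ binom(n + n^c, n) =: N`
  have hnc' : n ≤ n ^ c := by
    calc n = n ^ 1 := (pow_one n).symm
      _ ≤ n ^ c := Nat.pow_le_pow_right hn1 hc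
  have hN : 2 ^ n ≤ (n + n ^ c).choose n := by
    refine (two_pow_le_centralBinom' n).trans ?_
    rw [two_mul]
    exact Nat.choose_le_choose n (by omega)
  -- `s^e ≤ 2^{(L+1)² e}`
  have hs : (n ^ (L + 1)) ^ e ≤ 2 ^ ((L + 1) ^ 2 * e) := by
    calc (n ^ (L + 1)) ^ e ≤ ((2 ^ (L + 1)) ^ (L + 1)) ^ e :=
          Nat.pow_le_pow_left (Nat.pow_le_pow_left hnL' _) _
      _ = 2 ^ ((L + 1) ^ 2 * e) := by rw [← pow_mul, ← pow_mul]; ring_nf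
  have hse1 : 1 ≤ (n ^ (L + 1)) ^ e := Nat.one_le_pow _ _ (Nat.one_le_pow _ _ hn1)
  refine ⟨hn2, Nat.pow_le_pow_right hn1 (by omega), ?_, ?_, ?_,
    by simpa using (h₄ n hn₄).trans hN⟩
  · -- `s^e + 1 ≤ 2^{(L+1)² e + 1} ≤ 2^n ≤ N`
    have h1 : (n ^ (L + 1)) ^ e + 1 ≤ 2 ^ ((L + 1) ^ 2 * e + 1) := by
      have e2 : 2 ^ ((L + 1) ^ 2 * e + 1) = 2 * 2 ^ ((L + 1) ^ 2 * e) := by ring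
      rw [e2]; omega
    have h2 : 2 ^ ((L + 1) ^ 2 * e + 1) ≤ 2 ^ n :=
      Nat.pow_le_pow_right (by norm_num) (by omega)
    exact h1.trans (h2.trans hN)
  · -- `W`-type bound `≤ (2(a+1) + 4(c+2) + 2) n^{c+2} ≤ 2^n ≤ N`
    exact (gt_poly_le n a c L hLle hn1).trans ((h₂ n hn₂).trans hN)
  · -- witness exponent: `s^e · E ≤ 2^{(L+1)²e} · 2^{(c+2)(L+1) + 4(c+2) + 4} < 2^n ≤ N`
    have hE : (n + n ^ c) * (0 + 1) + n ^ c * (2 * (L + 1) * (L + 1 + c)) + 2 ≤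
        2 ^ ((c + 2) * (L + 1) + (4 * (c + 2) + 4)) := by
      refine (gt_poly_le n 0 c L hLle hn1).trans ?_
      have h1 : n ^ (c + 2) ≤ 2 ^ ((c + 2) * (L + 1)) := by
        rw [mul_comm, pow_mul]; exact Nat.pow_le_pow_left hnL' _
      have h2 : 2 * (0 + 1) + 4 * (c + 2) + 2 ≤ 2 ^ (4 * (c + 2) + 4) := by
        have := @Nat.lt_two_pow_self (4 * (c + 2) + 4)
        omega
      calc (2 * (0 + 1) + 4 * (c + 2) + 2) * n ^ (c + 2)
          ≤ 2 ^ (4 * (c + 2) + 4) * 2 ^ ((c + 2) * (L + 1)) := Nat.mul_le_mul h2 h1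
        _ = 2 ^ ((c + 2) * (L + 1) + (4 * (c + 2) + 4)) := by rw [← pow_add, add_comm]
    calc (n ^ (L + 1)) ^ e * ((n + n ^ c) * (0 + 1) + n ^ c * (2 * (L + 1) * (L + 1 + c)) + 2)
        ≤ 2 ^ ((L + 1) ^ 2 * e) * 2 ^ ((c + 2) * (L + 1) + (4 * (c + 2) + 4)) :=
          Nat.mul_le_mul hs hE
      _ = 2 ^ ((L + 1) ^ 2 * e + ((c + 2) * (L + 1) + (4 * (c + 2) + 4))) := by rw [← pow_add]
      _ < 2 ^ ((L + 1) ^ 2 * e + ((c + 2) * (L + 1) + (4 * (c + 2) + 4)) + 1) :=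
          Nat.pow_lt_pow_right (by norm_num) (by omega)
      _ ≤ 2 ^ n := Nat.pow_le_pow_right (by norm_num) (by omega)
      _ ≤ (n + n ^ c).choose n := hN

/-- The number of coefficient variables at degree `d`: `N = |x^{≤ d}| = binom(n + d, n)`
(print: "for `N = binom(n + d, n)`", before Def. 1.1; `GKSS2017.ncard_degLE` up to
`binom(n+d, d) = binom(n+d, n)`).
[cite: ChatterjeeKumarRamyaSaptharishiTengse2020, §1.1 before Def. 1.1 (arXiv v4)] locator: HOME/lit/src/2004.14147/main.tex L170 -/
theorem natCard_monomialsDegLE (n d : ℕ) : Nat.card (monomialsDegLE n d) = (n + d).choose n := by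
  rw [Nat.choose_symm_add]
  exact GKSS2017.ncard_degLE n d

/-- **CKRST 2020, Theorem 1.6 with "coefficients as large as `N`" (§1.3 remark, TeX L258), in the
AS-PRINTED shape of `CKRST2020_thm_1_1`:** for every `c ≥ 1` and `a₀` there is ONE family
`P_n ∈ ℂ[z_m : m ∈ x^{≤ n^c}]` with size and degree `≤ N^{a₀+6}` eventually, `N = binom(n + n^c, n)`,
such that for every size exponent `k`, for all large `n`, `P_n(coeff f) = 0` for every `f` of
degree `≤ n^c` and size `≤ n^k` whose coefficients are integers of modulus `≤ N^{a₀}`, and, for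
all large `n`, `P_n(coeff h_n) ≠ 0` for some `{-1,0,1}`-polynomial `h_n` of degree `≤ n^c`
(`CKRST2020_thm_1_1` is the sub-case `{-1,0,1} ⊆ [-N^{a₀}, N^{a₀}]`, up to the value of the
exponent; print: `a₀ = 1`). Built, as in the printed proof, on `𝒞(n, n^c, s_n)` with the barely
super-polynomial schedule `s_n = n^{⌊log₂ n⌋+1}`.
[cite: ChatterjeeKumarRamyaSaptharishiTengse2020, Thm. 1.6 (proof, §4) with the §1.3 remark after it] locator: HOME/lit/src/2004.14147/main.tex L258, L1396–L1411 -/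
theorem thm_1_1_intBox (a₀ c : ℕ) (hc : 1 ≤ c) :
    ∃ (e : ℕ) (P : (n : ℕ) → MvPolynomial (monomialsDegLE n (n ^ c)) ℂ),
      (∃ n₀ : ℕ, ∀ n ≥ n₀, complexity (P n) ≤ ((n + n ^ c).choose n) ^ e ∧
        (P n).totalDegree ≤ ((n + n ^ c).choose n) ^ e) ∧
      (∀ k : ℕ, ∃ n₀ : ℕ, ∀ n ≥ n₀, ∀ f ∈ vpSlice ℂ n (n ^ c) (n ^ k),
        f ∈ intBoxSlice ℂ n (((n + n ^ c).choose n) ^ a₀) →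
        eval (coeffVector (monomialsDegLE n (n ^ c)) f) (P n) = 0) ∧
      (∃ n₀ : ℕ, ∀ n ≥ n₀, ∃ h ∈ signCoeffSlice ℂ n, h.totalDegree ≤ n ^ c ∧
        eval (coeffVector (monomialsDegLE n (n ^ c)) h) (P n) ≠ 0) := by
  classical
  obtain ⟨e, hmain⟩ := exists_equation_vpSlice_intBox
  -- the family: for admissible `n`, the equation for `𝒞(n, n^c, n^{L+1}) ∩ [-N^{a₀}, N^{a₀}]`
  have key : ∀ n : ℕ, ∃ (H : Finset (Fin n → ℤ)) (P : MvPolynomial (monomialsDegLE n (n ^ c)) ℂ),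
      (2 ≤ n ∧ n ^ c ≤ n ^ (Nat.log 2 n + 1)) →
      (∀ a ∈ H, ∀ i, 1 ≤ a i ∧ a i ≤ ((n ^ (Nat.log 2 n + 1) * n ^ c) ^ 2 : ℕ)) ∧
      H.card ≤ (n ^ (Nat.log 2 n + 1)) ^ e ∧ P ≠ 0 ∧
      complexity P ≤ 20 * ((n ^ (Nat.log 2 n + 1)) ^ e + 1) *
          (Nat.card (monomialsDegLE n (n ^ c)) * ((n + n ^ c).choose n) ^ a₀ + 1) *
          (Nat.card (monomialsDegLE n (n ^ c)) + 1) *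
          (Nat.log 2 (Nat.card (monomialsDegLE n (n ^ c)) * ((n + n ^ c).choose n) ^ a₀ *
            ((n ^ (Nat.log 2 n + 1) * n ^ c) ^ 2) ^ (n ^ c)) + 2) ^ 2 ∧
      P.totalDegree ≤ 10 * ((n ^ (Nat.log 2 n + 1)) ^ e + 1) *
          (Nat.card (monomialsDegLE n (n ^ c)) * ((n + n ^ c).choose n) ^ a₀ + 1) *
          (Nat.log 2 (Nat.card (monomialsDegLE n (n ^ c)) * ((n + n ^ c).choose n) ^ a₀ *
            ((n ^ (Nat.log 2 n + 1) * n ^ c) ^ 2) ^ (n ^ c)) + 2) ^ 2 ∧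
      (∀ f : MvPolynomial (Fin n) ℂ, f.totalDegree ≤ n ^ c →
        (∀ m, ∃ z : ℤ, coeff m f = (z : ℂ) ∧ |z| ≤ (((n + n ^ c).choose n) ^ a₀ : ℕ)) →
        (eval (coeffVector (monomialsDegLE n (n ^ c)) f) P = 0 ↔
          (f ≠ 0 → ∃ a ∈ H, eval (fun j => ((a j : ℤ) : ℂ)) f ≠ 0))) ∧
      (∀ f ∈ vpSlice ℂ n (n ^ c) (n ^ (Nat.log 2 n + 1)),
        (∀ m, ∃ z : ℤ, coeff m f = (z : ℂ) ∧ |z| ≤ (((n + n ^ c).choose n) ^ a₀ : ℕ)) →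
        eval (coeffVector (monomialsDegLE n (n ^ c)) f) P = 0) := by
    intro n
    by_cases hn : 2 ≤ n ∧ n ^ c ≤ n ^ (Nat.log 2 n + 1)
    · have hns : n ≤ n ^ (Nat.log 2 n + 1) := by
        calc n = n ^ 1 := (pow_one n).symm
          _ ≤ n ^ (Nat.log 2 n + 1) := Nat.pow_le_pow_right (by omega) (by omega)
      have hd1 : 1 ≤ n ^ c := Nat.one_le_pow _ _ (by omega)
      obtain ⟨H, P, h⟩ := hmain n (n ^ c) (n ^ (Nat.log 2 n + 1)) (((n + n ^ c).choose n) ^ a₀)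
        (by omega) hns hd1 hn.2 (le_trans hn.1 hns)
      exact ⟨H, P, fun _ => h⟩
    · exact ⟨∅, 0, fun h => absurd h hn⟩
  choose H P hHP using key
  obtain ⟨n₀, hthr⟩ := general_thresholds a₀ c e hc
  -- everything at an admissible `n ≥ n₀`
  have main : ∀ n ≥ n₀,
      (complexity (P n) ≤ ((n + n ^ c).choose n) ^ (a₀ + 6) ∧
        (P n).totalDegree ≤ ((n + n ^ c).choose n) ^ (a₀ + 6)) ∧
      (∀ f ∈ vpSlice ℂ n (n ^ c) (n ^ (Nat.log 2 n + 1)),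
        f ∈ intBoxSlice ℂ n (((n + n ^ c).choose n) ^ a₀) →
        eval (coeffVector (monomialsDegLE n (n ^ c)) f) (P n) = 0) ∧
      (∃ h ∈ signCoeffSlice ℂ n, h.totalDegree ≤ n ^ c ∧
        eval (coeffVector (monomialsDegLE n (n ^ c)) h) (P n) ≠ 0) := by
    intro n hn
    obtain ⟨hn2, hcs, hT1, hT2, hT3, hT80⟩ := hthr n hn
    obtain ⟨hHB, hHcard, hP0, hPL, hPdeg, hPiff, hvan⟩ := hHP n ⟨hn2, hcs⟩
    set L := Nat.log 2 n with hL
    set N := (n + n ^ c).choose n with hN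
    have hNcard : Nat.card (monomialsDegLE n (n ^ c)) = N := natCard_monomialsDegLE n (n ^ c)
    rw [hNcard] at hPL hPdeg
    set s := n ^ (L + 1) with hs
    have hn1 : 1 ≤ n := by omega
    have hN1 : 1 ≤ N := by omega
    have hA1 : 1 ≤ N ^ a₀ := Nat.one_le_pow _ _ hN1
    have hNA : 1 ≤ N * N ^ a₀ := Nat.mul_pos (by omega) (by omega)
    have hNA' : N * N ^ a₀ + 1 ≤ 2 * N ^ (a₀ + 1) := by rw [pow_succ']; omega
    have hNu : N ≤ 2 ^ (n + n ^ c) := Nat.choose_le_two_pow _ _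
    have hnL' : n ≤ 2 ^ (L + 1) := (Nat.lt_pow_succ_log_self Nat.one_lt_two n).le
    have h2X : (s * n ^ c) ^ 2 ≤ 2 ^ (2 * (L + 1) * (L + 1 + c)) := by
      calc (s * n ^ c) ^ 2 = (n ^ (L + 1 + c)) ^ 2 := by rw [hs, ← pow_add]
        _ ≤ ((2 ^ (L + 1)) ^ (L + 1 + c)) ^ 2 := by gcongr
        _ = 2 ^ (2 * (L + 1) * (L + 1 + c)) := by rw [← pow_mul, ← pow_mul]; ring_nf
    have hW : Nat.log 2 (N * N ^ a₀ * ((s * n ^ c) ^ 2) ^ (n ^ c)) + 2 ≤ N := by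
      refine le_trans ?_ hT2
      have h := log_two_le_of_bounds N a₀ ((s * n ^ c) ^ 2) (n ^ c) (n + n ^ c)
        (2 * (L + 1) * (L + 1 + c)) hNu h2X
      omega
    -- (1) size and degree
    have hsize : complexity (P n) ≤ N ^ (a₀ + 6) := by
      refine hPL.trans ?_
      calc 20 * (s ^ e + 1) * (N * N ^ a₀ + 1) * (N + 1) *
            (Nat.log 2 (N * N ^ a₀ * ((s * n ^ c) ^ 2) ^ (n ^ c)) + 2) ^ 2
          ≤ 20 * N * (2 * N ^ (a₀ + 1)) * (2 * N) * N ^ 2 := by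
            gcongr
            · omega
        _ = 80 * N ^ (a₀ + 5) := by ring
        _ ≤ N * N ^ (a₀ + 5) := Nat.mul_le_mul_right _ hT80
        _ = N ^ (a₀ + 6) := by ring
    have hdegP : (P n).totalDegree ≤ N ^ (a₀ + 6) := by
      refine hPdeg.trans ?_
      calc 10 * (s ^ e + 1) * (N * N ^ a₀ + 1) *
            (Nat.log 2 (N * N ^ a₀ * ((s * n ^ c) ^ 2) ^ (n ^ c)) + 2) ^ 2
          ≤ 10 * N * (2 * N ^ (a₀ + 1)) * N ^ 2 := by gcongr
        _ = 20 * N ^ (a₀ + 4) := by ring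
        _ ≤ N * N ^ (a₀ + 4) := Nat.mul_le_mul_right _ (by omega)
        _ = N ^ (a₀ + 5) := by ring
        _ ≤ N ^ (a₀ + 6) := Nat.pow_le_pow_right hN1 (by omega)
    -- (2) the `{-1,0,1}` witness of degree `≤ n^c` vanishing on `ℋ_n`
    have hHabs : ∀ a ∈ H n, ∀ j, |a j| ≤ (((s * n ^ c) ^ 2 : ℕ) : ℤ) := by
      intro a ha j
      obtain ⟨h1, h2⟩ := hHB a ha j
      rw [abs_le]; constructor <;> linarith
    have hB1 : 1 ≤ (s * n ^ c) ^ 2 :=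
      Nat.one_le_pow _ _ (Nat.mul_pos (Nat.one_le_pow _ _ hn1) (Nat.one_le_pow _ _ hn1))
    have hcount : (2 * (Nat.card (monomialsDegLE n (n ^ c)) * ((s * n ^ c) ^ 2) ^ (n ^ c)) + 1) ^
        (H n).card < 2 ^ Nat.card (monomialsDegLE n (n ^ c)) := by
      rw [hNcard]
      have hE : 2 * (N * ((s * n ^ c) ^ 2) ^ (n ^ c)) + 1 ≤
          2 ^ ((n + n ^ c) * (0 + 1) + n ^ c * (2 * (L + 1) * (L + 1 + c)) + 2) := by
        have h0 := log_two_le_of_bounds N 0 ((s * n ^ c) ^ 2) (n ^ c) (n + n ^ c)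
          (2 * (L + 1) * (L + 1 + c)) hNu h2X
        rw [pow_zero, mul_one] at h0
        have hlt := Nat.lt_pow_succ_log_self Nat.one_lt_two (N * ((s * n ^ c) ^ 2) ^ (n ^ c))
        have hmono : 2 ^ (Nat.log 2 (N * ((s * n ^ c) ^ 2) ^ (n ^ c)) + 1) ≤
            2 ^ ((n + n ^ c) * (0 + 1) + n ^ c * (2 * (L + 1) * (L + 1 + c)) + 1) :=
          Nat.pow_le_pow_right (by norm_num) (by omega)
        have e2 : 2 ^ ((n + n ^ c) * (0 + 1) + n ^ c * (2 * (L + 1) * (L + 1 + c)) + 2) =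
            2 * 2 ^ ((n + n ^ c) * (0 + 1) + n ^ c * (2 * (L + 1) * (L + 1 + c)) + 1) := by ring
        rw [e2]
        omega
      have hexp : (H n).card * ((n + n ^ c) * (0 + 1) + n ^ c * (2 * (L + 1) * (L + 1 + c)) + 2) <
          N := lt_of_le_of_lt (Nat.mul_le_mul_right _ hHcard) hT3
      calc (2 * (N * ((s * n ^ c) ^ 2) ^ (n ^ c)) + 1) ^ (H n).card
          ≤ (2 ^ ((n + n ^ c) * (0 + 1) + n ^ c * (2 * (L + 1) * (L + 1 + c)) + 2)) ^ (H n).card :=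
            Nat.pow_le_pow_left hE _
        _ = 2 ^ ((H n).card * ((n + n ^ c) * (0 + 1) + n ^ c * (2 * (L + 1) * (L + 1 + c)) + 2)) := by
            rw [← pow_mul, mul_comm]
        _ < 2 ^ N := Nat.pow_lt_pow_right (by norm_num) hexp
    obtain ⟨g, hg0, hgd, hgs, hgv⟩ :=
      exists_signCoeff_vanishing_on ℂ n (n ^ c) ((s * n ^ c) ^ 2) hB1 (H n) hHabs hcount
    have hgbox : g ∈ intBoxSlice ℂ n (N ^ a₀) := signCoeffSlice_subset_intBoxSlice ℂ hA1 hgs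
    have hgP : eval (coeffVector (monomialsDegLE n (n ^ c)) g) (P n) ≠ 0 := by
      intro h0
      obtain ⟨a, ha, hne⟩ := (hPiff g hgd hgbox).mp h0 hg0
      exact hne (hgv a ha)
    exact ⟨⟨hsize, hdegP⟩, fun f hf hfbox => hvan f hf hfbox, g, hgs, hgd, hgP⟩
  refine ⟨a₀ + 6, P, ⟨n₀, fun n hn => (main n hn).1⟩, fun k => ?_,
    ⟨n₀, fun n hn => (main n hn).2.2⟩⟩
  -- clause 2: for `n ≥ max n₀ 2^k`, `n^k ≤ n^{L+1}`, so `𝒞(n, n^c, n^k) ⊆ 𝒞(n, n^c, n^{L+1})`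
  refine ⟨max n₀ (2 ^ k), fun n hn f hf hfbox => ?_⟩
  have hn₀ : n₀ ≤ n := le_trans (le_max_left _ _) hn
  have hnk : 2 ^ k ≤ n := le_trans (le_max_right _ _) hn
  have hn1 : 1 ≤ n := le_trans Nat.one_le_two_pow hnk
  have hkL : k ≤ Nat.log 2 n := Nat.le_log_of_pow_le Nat.one_lt_two hnk
  have hks : n ^ k ≤ n ^ (Nat.log 2 n + 1) := Nat.pow_le_pow_right hn1 (by omega)
  exact (main n hn₀).2.1 f ⟨hf.1, hf.2.trans hks⟩ hfbox

/-! ### Theorem 1.8 AS PRINTED (`VNP`, degree `n^c`, `N = binom(n + n^c, n)`) for the box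
`[-N^{a₀}, N^{a₀}]` — the remark after Thm. 1.8 (TeX L300) read literally -/

/-- `vnpSlice` is monotone in the size parameter (the same statement as the route file's
`…BarrierLever.NaturalProofsSeparateVNP.VNPAsPrinted.vnpSlice_mono` under `Summits/`, which
`Literature/` cannot import; restated here for `thm_1_3_intBox`).
[cite: ChatterjeeKumarRamyaSaptharishiTengse2020, Def. 2.3 (ECCC) = v2 ‹Def 8›] -/
theorem vnpSlice_mono_size {n d t t' : ℕ} (h : t ≤ t') : vnpSlice ℂ n d t ⊆ vnpSlice ℂ n d t' := by
  rintro f ⟨hfd, m, hm, g, hgc, hgd, hfg⟩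
  exact ⟨hfd, m, hm.trans h, g, hgc.trans h, hgd.trans h, hfg⟩

/-- Arithmetic: `(L+1)² + 3 ≤ 4(c+2) n²` (`L ≤ n`, `n ≥ 1`). [folklore] -/
private theorem vt_quad_le (n c L : ℕ) (hLn : L ≤ n) (hn1 : 1 ≤ n) :
    (L + 1) ^ 2 + 3 ≤ 4 * (c + 2) * n ^ 2 := by
  have h1 : L + 1 ≤ 2 * n := by omega
  have h2 : (L + 1) ^ 2 ≤ (2 * n) ^ 2 := Nat.pow_le_pow_left h1 2
  have h3 : 1 ≤ n ^ 2 := Nat.one_le_pow _ _ hn1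
  calc (L + 1) ^ 2 + 3 ≤ (2 * n) ^ 2 + 3 * n ^ 2 := Nat.add_le_add h2 (by omega)
    _ = 7 * n ^ 2 := by ring
    _ ≤ 4 * (c + 2) * n ^ 2 := Nat.mul_le_mul_right _ (by omega)

/-- Arithmetic: `(n + n^c)(a+1) + n^c K + 2 ≤ (2(a+1) + 4(c+2) + 2) n^{c+2}` when
`K ≤ 4(c+2) n²`, `n ≥ 1`. [folklore] -/
private theorem vt_poly_le (n a c K : ℕ) (hK : K ≤ 4 * (c + 2) * n ^ 2) (hn1 : 1 ≤ n) :
    (n + n ^ c) * (a + 1) + n ^ c * K + 2 ≤ (2 * (a + 1) + 4 * (c + 2) + 2) * n ^ (c + 2) := by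
  have h1 : (n + n ^ c) * (a + 1) ≤ 2 * n ^ (c + 2) * (a + 1) :=
    Nat.mul_le_mul_right _ (gt_sum_le n c hn1)
  have h2 : n ^ c * K ≤ n ^ c * (4 * (c + 2) * n ^ 2) := Nat.mul_le_mul_left _ hK
  have h3 : 1 ≤ n ^ (c + 2) := Nat.one_le_pow _ _ hn1
  calc (n + n ^ c) * (a + 1) + n ^ c * K + 2
      ≤ 2 * n ^ (c + 2) * (a + 1) + n ^ c * (4 * (c + 2) * n ^ 2) + 2 * n ^ (c + 2) :=
        Nat.add_le_add (Nat.add_le_add h1 h2) (by omega)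
    _ = (2 * (a + 1) + 4 * (c + 2) + 2) * n ^ (c + 2) := by ring

/-- Arithmetic: `n κ + e κ + 3 ≤ 4(c+2)(e+2) n³` when `κ ≤ 4(c+2) n²`, `n ≥ 1`. [folklore] -/
private theorem vt_lin_le (n c e κ : ℕ) (hκ : κ ≤ 4 * (c + 2) * n ^ 2) (hn1 : 1 ≤ n) :
    n * κ + e * κ + 3 ≤ 4 * (c + 2) * (e + 2) * n ^ 3 := by
  have h1 : n * κ ≤ n * (4 * (c + 2) * n ^ 2) := Nat.mul_le_mul_left _ hκ
  have h2 : e * κ ≤ e * (4 * (c + 2) * n ^ 2) := Nat.mul_le_mul_left _ hκ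
  have h3 : e * (4 * (c + 2) * n ^ 2) ≤ e * (4 * (c + 2) * n ^ 2) * n :=
    Nat.le_mul_of_pos_right _ hn1
  have h4 : 3 ≤ 4 * (c + 2) * n ^ 3 :=
    le_trans (by omega : 3 ≤ 4 * (c + 2)) (Nat.le_mul_of_pos_right _ (Nat.one_le_pow _ _ hn1))
  calc n * κ + e * κ + 3
      ≤ n * (4 * (c + 2) * n ^ 2) + e * (4 * (c + 2) * n ^ 2) * n + 4 * (c + 2) * n ^ 3 := by omega
    _ = 4 * (c + 2) * (e + 2) * n ^ 3 := by ring

/-- Arithmetic: `s = n + n^{L+1} + 1 ≤ 2^{(L+1)² + 2}` when `n ≤ 2^{L+1}`, `n ≥ 1`. [folklore] -/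
private theorem vt_s_le (n L : ℕ) (hn1 : 1 ≤ n) (hnL' : n ≤ 2 ^ (L + 1)) :
    2 * (n + n ^ (L + 1) + 1) ≤ 2 ^ ((L + 1) ^ 2 + 3) := by
  have h1 : n ≤ n ^ (L + 1) := by
    calc n = n ^ 1 := (pow_one n).symm
      _ ≤ n ^ (L + 1) := Nat.pow_le_pow_right hn1 (by omega)
  have h2 : 1 ≤ n ^ (L + 1) := Nat.one_le_pow _ _ hn1
  have h3 : n ^ (L + 1) ≤ 2 ^ ((L + 1) ^ 2) := by
    calc n ^ (L + 1) ≤ (2 ^ (L + 1)) ^ (L + 1) := Nat.pow_le_pow_left hnL' _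
      _ = 2 ^ ((L + 1) ^ 2) := by rw [← pow_mul]; ring_nf
  have e8 : 2 ^ ((L + 1) ^ 2 + 3) = 8 * 2 ^ ((L + 1) ^ 2) := by ring
  rw [e8]; omega

/-- Arithmetic: the hitting-set count of v4 Lemma 3.7, `T = s^e (log₂((2s)^n s^e + 1) + 1) + 1`, is
`≤ 2^{eκ} (nκ + eκ + 3)` when `2s ≤ 2^κ`, `s ≥ 1`. [folklore] -/
private theorem vt_T_le (s e n κ : ℕ) (hs : 2 * s ≤ 2 ^ κ) (hs1 : 1 ≤ s) :
    s ^ e * (Nat.log 2 ((2 * s) ^ n * s ^ e + 1) + 1) + 1 ≤ 2 ^ (e * κ) * (n * κ + e * κ + 3) := by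
  have hs' : s ≤ 2 ^ κ := le_trans (by omega) hs
  have h1 : s ^ e ≤ 2 ^ (e * κ) := by
    rw [mul_comm, pow_mul]; exact Nat.pow_le_pow_left hs' _
  have h2 : (2 * s) ^ n ≤ 2 ^ (n * κ) := by
    rw [mul_comm n, pow_mul]; exact Nat.pow_le_pow_left hs _
  have h3 : (2 * s) ^ n * s ^ e + 1 ≤ 2 ^ (n * κ + e * κ + 1) := by
    have h := Nat.mul_le_mul h2 h1
    rw [← pow_add] at h
    have h1' : 1 ≤ 2 ^ (n * κ + e * κ) := Nat.one_le_two_pow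
    rw [pow_succ]; omega
  have h4 : Nat.log 2 ((2 * s) ^ n * s ^ e + 1) ≤ n * κ + e * κ + 1 := by
    have := Nat.log_mono_right (b := 2) h3
    rwa [Nat.log_pow Nat.one_lt_two] at this
  have h5 : 1 ≤ 2 ^ (e * κ) := Nat.one_le_two_pow
  calc s ^ e * (Nat.log 2 ((2 * s) ^ n * s ^ e + 1) + 1) + 1
      ≤ 2 ^ (e * κ) * (n * κ + e * κ + 2) + 2 ^ (e * κ) :=
        Nat.add_le_add (Nat.mul_le_mul h1 (by omega)) h5
    _ = 2 ^ (e * κ) * (n * κ + e * κ + 3) := by ring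

/-- Arithmetic: the two exponents of the `VNP` box theorem are dominated by the key inequality
(`C₁`, `C₁₂` opaque constants). [folklore] -/
private theorem vt_exp_le (L c e C₁ C₁₂ X : ℕ)
    (hkey : (e + c + 5) * (L + 1) ^ 2 + (3 * e + C₁₂ + C₁ + 2) ≤ X) :
    e * ((L + 1) ^ 2 + 3) + 3 * (L + 1) + (C₁ + 1) ≤ X ∧
      e * ((L + 1) ^ 2 + 3) + (c + 5) * (L + 1) + C₁₂ + 1 ≤ X := by
  have h0 : L + 1 ≤ (L + 1) ^ 2 := Nat.le_self_pow two_ne_zero _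
  have h1 : (c + 5) * (L + 1) ≤ (c + 5) * (L + 1) ^ 2 := Nat.mul_le_mul_left _ h0
  have h2 : 3 * (L + 1) ^ 2 ≤ (c + 5) * (L + 1) ^ 2 := Nat.mul_le_mul_right _ (by omega)
  have e1 : (e + c + 5) * (L + 1) ^ 2 = e * (L + 1) ^ 2 + (c + 5) * (L + 1) ^ 2 := by ring
  have e2 : e * ((L + 1) ^ 2 + 3) = e * (L + 1) ^ 2 + 3 * e := by ring
  constructor <;> omega

/-- The thresholds for Thm. 1.8's box version: degree `d = n^c` (`c ≥ 1`), `VNP`-size schedule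
`n^{L+1}`, definability parameter `s = n + n^{L+1} + 1`, `L = ⌊log₂ n⌋`, `N = binom(n + n^c, n)`:
for fixed `a, c, e` and all large `n`. [folklore] -/
private theorem vnp_general_thresholds (a c e : ℕ) (hc : 1 ≤ c) : ∃ n₀ : ℕ, ∀ n ≥ n₀,
    2 ≤ n ∧ n ^ c ≤ n ^ (Nat.log 2 n + 1) ∧
    (n + n ^ (Nat.log 2 n + 1) + 1) ^ e *
          (Nat.log 2 ((2 * (n + n ^ (Nat.log 2 n + 1) + 1)) ^ n *
            (n + n ^ (Nat.log 2 n + 1) + 1) ^ e + 1) + 1) + 1 + 1 ≤ (n + n ^ c).choose n ∧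
    (n + n ^ c) * (a + 1) + n ^ c * ((Nat.log 2 n + 1) ^ 2 + 3) + 2 ≤ (n + n ^ c).choose n ∧
    ((n + n ^ (Nat.log 2 n + 1) + 1) ^ e *
          (Nat.log 2 ((2 * (n + n ^ (Nat.log 2 n + 1) + 1)) ^ n *
            (n + n ^ (Nat.log 2 n + 1) + 1) ^ e + 1) + 1) + 1) *
        ((n + n ^ c) * (0 + 1) + n ^ c * ((Nat.log 2 n + 1) ^ 2 + 3) + 2) < (n + n ^ c).choose n ∧
    80 ≤ (n + n ^ c).choose n := by
  obtain ⟨L₀, hL₀⟩ := eventually_quad_le_two_pow' (e + c + 5)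
    (3 * e + 4 * (c + 2) * (e + 2) * (2 * (0 + 1) + 4 * (c + 2) + 2) + 4 * (c + 2) * (e + 2) + 2)
  obtain ⟨n₂, h₂⟩ := eventually_mul_pow_le_two_pow (2 * (a + 1) + 4 * (c + 2) + 2) (c + 2)
  obtain ⟨n₄, h₄⟩ := eventually_mul_pow_le_two_pow 80 0
  refine ⟨max (max (2 ^ L₀) (2 ^ c)) (max (max n₂ n₄) 2), fun n hn => ?_⟩
  simp only [ge_iff_le, max_le_iff] at hn
  obtain ⟨⟨hnL₀, hnc⟩, ⟨hn₂, hn₄⟩, hn2⟩ := hn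
  set L := Nat.log 2 n with hL
  have hn0 : n ≠ 0 := by omega
  have hn1 : 1 ≤ n := by omega
  have hLn : 2 ^ L ≤ n := by rw [hL]; exact Nat.pow_log_le_self 2 hn0
  have hnL : n < 2 ^ (L + 1) := by rw [hL]; exact Nat.lt_pow_succ_log_self Nat.one_lt_two n
  have hnL' : n ≤ 2 ^ (L + 1) := hnL.le
  have hL₀L : L₀ ≤ L := by rw [hL]; exact Nat.le_log_of_pow_le Nat.one_lt_two hnL₀
  have hcL : c ≤ L := by rw [hL]; exact Nat.le_log_of_pow_le Nat.one_lt_two hnc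
  have hLle : L ≤ n := by rw [hL]; exact (Nat.log_lt_self 2 hn0).le
  obtain ⟨hx1, hx2⟩ := vt_exp_le L c e (4 * (c + 2) * (e + 2))
    (4 * (c + 2) * (e + 2) * (2 * (0 + 1) + 4 * (c + 2) + 2)) n ((hL₀ L hL₀L).trans hLn)
  -- `2^n ≤ binom(2n, n) ≤ binom(n + n^c, n) =: N`
  have hnc' : n ≤ n ^ c := by
    calc n = n ^ 1 := (pow_one n).symm
      _ ≤ n ^ c := Nat.pow_le_pow_right hn1 hc
  have hN : 2 ^ n ≤ (n + n ^ c).choose n := by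
    refine (two_pow_le_centralBinom' n).trans ?_
    rw [two_mul]
    exact Nat.choose_le_choose n (by omega)
  -- the schedule
  set s := n + n ^ (L + 1) + 1 with hs
  set κ := (L + 1) ^ 2 + 3 with hκ
  have hκle : κ ≤ 4 * (c + 2) * n ^ 2 := vt_quad_le n c L hLle hn1
  have h2s : 2 * s ≤ 2 ^ κ := vt_s_le n L hn1 hnL'
  have hT := (vt_T_le s e n κ h2s (by omega)).trans
    (Nat.mul_le_mul_left (2 ^ (e * κ)) (vt_lin_le n c e κ hκle hn1))
  -- `hT : T ≤ 2^{eκ} · (C₁ n³)`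
  have hn3 : n ^ 3 ≤ 2 ^ (3 * (L + 1)) := by
    rw [mul_comm, pow_mul]; exact Nat.pow_le_pow_left hnL' _
  refine ⟨hn2, Nat.pow_le_pow_right hn1 (by omega), ?_, ?_, ?_, by simpa using (h₄ n hn₄).trans hN⟩
  · -- `T + 1 ≤ 2^{eκ} (C₁+1) n³ ≤ 2^{eκ + 3(L+1) + C₁ + 1} ≤ 2^n ≤ N`
    have h1 : 4 * (c + 2) * (e + 2) + 1 ≤ 2 ^ (4 * (c + 2) * (e + 2) + 1) := Nat.lt_two_pow_self.le
    have h1' : 1 ≤ 2 ^ (e * κ) * n ^ 3 := Nat.mul_pos Nat.one_le_two_pow (Nat.one_le_pow _ _ hn1)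
    calc s ^ e * (Nat.log 2 ((2 * s) ^ n * s ^ e + 1) + 1) + 1 + 1
        ≤ 2 ^ (e * κ) * (4 * (c + 2) * (e + 2) * n ^ 3) + 2 ^ (e * κ) * n ^ 3 :=
          Nat.add_le_add hT h1'
      _ = 2 ^ (e * κ) * ((4 * (c + 2) * (e + 2) + 1) * n ^ 3) := by ring
      _ ≤ 2 ^ (e * κ) * (2 ^ (4 * (c + 2) * (e + 2) + 1) * 2 ^ (3 * (L + 1))) :=
          Nat.mul_le_mul_left _ (Nat.mul_le_mul h1 hn3)
      _ = 2 ^ (e * κ + 3 * (L + 1) + (4 * (c + 2) * (e + 2) + 1)) := by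
          rw [← pow_add, ← pow_add]; ring_nf
      _ ≤ 2 ^ n := Nat.pow_le_pow_right (by norm_num) (by rw [hκ]; exact hx1)
      _ ≤ (n + n ^ c).choose n := hN
  · -- `W`-type bound
    exact (vt_poly_le n a c κ hκle hn1).trans ((h₂ n hn₂).trans hN)
  · -- witness exponent: `T · E ≤ 2^{eκ} C₁ n³ · C₂ n^{c+2} ≤ 2^{eκ + (c+5)(L+1) + C₁C₂} < 2^n ≤ N`
    have hE := vt_poly_le n 0 c κ hκle hn1
    have h1 : 4 * (c + 2) * (e + 2) * (2 * (0 + 1) + 4 * (c + 2) + 2) ≤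
        2 ^ (4 * (c + 2) * (e + 2) * (2 * (0 + 1) + 4 * (c + 2) + 2)) := Nat.lt_two_pow_self.le
    have hn5 : n ^ (c + 5) ≤ 2 ^ ((c + 5) * (L + 1)) := by
      rw [mul_comm, pow_mul]; exact Nat.pow_le_pow_left hnL' _
    calc (s ^ e * (Nat.log 2 ((2 * s) ^ n * s ^ e + 1) + 1) + 1) *
          ((n + n ^ c) * (0 + 1) + n ^ c * κ + 2)
        ≤ 2 ^ (e * κ) * (4 * (c + 2) * (e + 2) * n ^ 3) *
            ((2 * (0 + 1) + 4 * (c + 2) + 2) * n ^ (c + 2)) := Nat.mul_le_mul hT hE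
      _ = 2 ^ (e * κ) * ((4 * (c + 2) * (e + 2) * (2 * (0 + 1) + 4 * (c + 2) + 2)) * n ^ (c + 5)) := by
          ring
      _ ≤ 2 ^ (e * κ) * (2 ^ (4 * (c + 2) * (e + 2) * (2 * (0 + 1) + 4 * (c + 2) + 2)) *
            2 ^ ((c + 5) * (L + 1))) := Nat.mul_le_mul_left _ (Nat.mul_le_mul h1 hn5)
      _ = 2 ^ (e * κ + (c + 5) * (L + 1) + 4 * (c + 2) * (e + 2) * (2 * (0 + 1) + 4 * (c + 2) + 2)) := by
          rw [← pow_add, ← pow_add]; ring_nf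
      _ < 2 ^ (e * κ + (c + 5) * (L + 1) +
            4 * (c + 2) * (e + 2) * (2 * (0 + 1) + 4 * (c + 2) + 2) + 1) :=
          Nat.pow_lt_pow_right (by norm_num) (by omega)
      _ ≤ 2 ^ n := Nat.pow_le_pow_right (by norm_num) (by rw [hκ]; exact hx2)
      _ ≤ (n + n ^ c).choose n := hN

/-- **CKRST 2020, Theorem 1.8 with "coefficients as large as `N`" (remark after Thm. 1.8, TeX L300),
in the AS-PRINTED shape of `CKRST2020_thm_1_3`:** for every `c ≥ 1` and `a₀` there is ONE family
`Q_n ∈ ℂ[z_m : m ∈ x^{≤ n^c}]` with size and degree `≤ N^{a₀+6}` eventually, `N = binom(n + n^c, n)`,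
such that for every size exponent `k`, for all large `n`, `Q_n(coeff f) = 0` for every `f` in the
`VNP` slice `vnpSlice ℂ n (n^c) (n^k)` whose coefficients are integers of modulus `≤ N^{a₀}`, and,
for all large `n`, `Q_n(coeff h_n) ≠ 0` for some `{-1,0,1}`-polynomial `h_n` of degree `≤ n^c`
(`CKRST2020_thm_1_3` is the sub-case `{-1,0,1} ⊆ [-N^{a₀}, N^{a₀}]`, up to the value of the
exponent). Built, as in the printed proof (§5.1 of ECCC = v4 Lemma 3.7 + Thm. 4.3), on the
`s`-definable slice with `s = n + n^{⌊log₂ n⌋+1} + 1` (`vnpSlice ℂ n d t ⊆ definableSlice ℂ n d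
(n + t + 1)`, `CKRST2020.vnpSlice_subset_definableSlice`), via `exists_equation_definableSlice_intBox`.
[cite: ChatterjeeKumarRamyaSaptharishiTengse2020, Thm. 1.8 (proof: Lemma 3.7 + Thm. 4.3, arXiv v4) with the remark after it] locator: HOME/lit/src/2004.14147/main.tex L300, L1334–L1411 -/
theorem thm_1_3_intBox (a₀ c : ℕ) (hc : 1 ≤ c) :
    ∃ (e : ℕ) (Q : (n : ℕ) → MvPolynomial (monomialsDegLE n (n ^ c)) ℂ),
      (∃ n₀ : ℕ, ∀ n ≥ n₀, complexity (Q n) ≤ ((n + n ^ c).choose n) ^ e ∧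
        (Q n).totalDegree ≤ ((n + n ^ c).choose n) ^ e) ∧
      (∀ k : ℕ, ∃ n₀ : ℕ, ∀ n ≥ n₀, ∀ f ∈ vnpSlice ℂ n (n ^ c) (n ^ k),
        f ∈ intBoxSlice ℂ n (((n + n ^ c).choose n) ^ a₀) →
        eval (coeffVector (monomialsDegLE n (n ^ c)) f) (Q n) = 0) ∧
      (∃ n₀ : ℕ, ∀ n ≥ n₀, ∃ h ∈ signCoeffSlice ℂ n, h.totalDegree ≤ n ^ c ∧
        eval (coeffVector (monomialsDegLE n (n ^ c)) h) (Q n) ≠ 0) := by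
  classical
  obtain ⟨e, hmain⟩ := exists_equation_definableSlice_intBox
  -- the family: for `n ≥ 2`, the equation for the `s`-definable slice, `s = n + n^{L+1} + 1`,
  -- meet the box `[-N^{a₀}, N^{a₀}]`
  have key : ∀ n : ℕ, ∃ (H : Finset (Fin n → ℤ)) (P : MvPolynomial (monomialsDegLE n (n ^ c)) ℂ),
      2 ≤ n →
      (∀ a ∈ H, ∀ i, 1 ≤ a i ∧ a i ≤ ((2 * (n + n ^ (Nat.log 2 n + 1) + 1) : ℕ) : ℤ)) ∧
      H.card ≤ (n + n ^ (Nat.log 2 n + 1) + 1) ^ e *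
          (Nat.log 2 ((2 * (n + n ^ (Nat.log 2 n + 1) + 1)) ^ n *
            (n + n ^ (Nat.log 2 n + 1) + 1) ^ e + 1) + 1) + 1 ∧ P ≠ 0 ∧
      complexity P ≤ 20 * (H.card + 1) *
          (Nat.card (monomialsDegLE n (n ^ c)) * ((n + n ^ c).choose n) ^ a₀ + 1) *
          (Nat.card (monomialsDegLE n (n ^ c)) + 1) *
          (Nat.log 2 (Nat.card (monomialsDegLE n (n ^ c)) * ((n + n ^ c).choose n) ^ a₀ *
            (2 * (n + n ^ (Nat.log 2 n + 1) + 1)) ^ (n ^ c)) + 2) ^ 2 ∧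
      P.totalDegree ≤ 10 * (H.card + 1) *
          (Nat.card (monomialsDegLE n (n ^ c)) * ((n + n ^ c).choose n) ^ a₀ + 1) *
          (Nat.log 2 (Nat.card (monomialsDegLE n (n ^ c)) * ((n + n ^ c).choose n) ^ a₀ *
            (2 * (n + n ^ (Nat.log 2 n + 1) + 1)) ^ (n ^ c)) + 2) ^ 2 ∧
      (∀ f : MvPolynomial (Fin n) ℂ, f.totalDegree ≤ n ^ c →
        (∀ m, ∃ z : ℤ, coeff m f = (z : ℂ) ∧ |z| ≤ (((n + n ^ c).choose n) ^ a₀ : ℕ)) →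
        (eval (coeffVector (monomialsDegLE n (n ^ c)) f) P = 0 ↔
          (f ≠ 0 → ∃ a ∈ H, eval (fun j => ((a j : ℤ) : ℂ)) f ≠ 0))) ∧
      (∀ f ∈ definableSlice ℂ n (n ^ c) (n + n ^ (Nat.log 2 n + 1) + 1),
        (∀ m, ∃ z : ℤ, coeff m f = (z : ℂ) ∧ |z| ≤ (((n + n ^ c).choose n) ^ a₀ : ℕ)) →
        eval (coeffVector (monomialsDegLE n (n ^ c)) f) P = 0) := by
    intro n
    by_cases hn : 2 ≤ n
    · obtain ⟨H, P, h⟩ := hmain n (n ^ c) (n + n ^ (Nat.log 2 n + 1) + 1)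
        (((n + n ^ c).choose n) ^ a₀) (by omega) (by omega) (by omega)
      exact ⟨H, P, fun _ => h⟩
    · exact ⟨∅, 0, fun h => absurd h hn⟩
  choose H P hHP using key
  obtain ⟨n₀, hthr⟩ := vnp_general_thresholds a₀ c e hc
  -- everything at an admissible `n ≥ n₀`
  have main : ∀ n ≥ n₀,
      (complexity (P n) ≤ ((n + n ^ c).choose n) ^ (a₀ + 6) ∧
        (P n).totalDegree ≤ ((n + n ^ c).choose n) ^ (a₀ + 6)) ∧
      (∀ f ∈ vnpSlice ℂ n (n ^ c) (n ^ (Nat.log 2 n + 1)),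
        f ∈ intBoxSlice ℂ n (((n + n ^ c).choose n) ^ a₀) →
        eval (coeffVector (monomialsDegLE n (n ^ c)) f) (P n) = 0) ∧
      (∃ h ∈ signCoeffSlice ℂ n, h.totalDegree ≤ n ^ c ∧
        eval (coeffVector (monomialsDegLE n (n ^ c)) h) (P n) ≠ 0) := by
    intro n hn
    obtain ⟨hn2, hcs, hT1, hT2, hT3, hT80⟩ := hthr n hn
    obtain ⟨hHB, hHcard, hP0, hPL, hPdeg, hPiff, hvan⟩ := hHP n hn2
    set L := Nat.log 2 n with hL
    set N := (n + n ^ c).choose n with hN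
    have hNcard : Nat.card (monomialsDegLE n (n ^ c)) = N := natCard_monomialsDegLE n (n ^ c)
    rw [hNcard] at hPL hPdeg
    set s := n + n ^ (L + 1) + 1 with hs
    have hn1 : 1 ≤ n := by omega
    have hN1 : 1 ≤ N := by omega
    have hA1 : 1 ≤ N ^ a₀ := Nat.one_le_pow _ _ hN1
    have hNA : 1 ≤ N * N ^ a₀ := Nat.mul_pos (by omega) (by omega)
    have hNA' : N * N ^ a₀ + 1 ≤ 2 * N ^ (a₀ + 1) := by rw [pow_succ']; omega
    have hNu : N ≤ 2 ^ (n + n ^ c) := Nat.choose_le_two_pow _ _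
    have hnL' : n ≤ 2 ^ (L + 1) := (Nat.lt_pow_succ_log_self Nat.one_lt_two n).le
    have h2s : 2 * s ≤ 2 ^ ((L + 1) ^ 2 + 3) := vt_s_le n L hn1 hnL'
    have hHc1 : (H n).card + 1 ≤ N := le_trans (Nat.add_le_add_right hHcard 1) hT1
    have hW : Nat.log 2 (N * N ^ a₀ * (2 * s) ^ (n ^ c)) + 2 ≤ N := by
      refine le_trans ?_ hT2
      have h := log_two_le_of_bounds N a₀ (2 * s) (n ^ c) (n + n ^ c) ((L + 1) ^ 2 + 3) hNu h2s
      omega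
    -- (1) size and degree
    have hsize : complexity (P n) ≤ N ^ (a₀ + 6) := by
      refine hPL.trans ?_
      calc 20 * ((H n).card + 1) * (N * N ^ a₀ + 1) * (N + 1) *
            (Nat.log 2 (N * N ^ a₀ * (2 * s) ^ (n ^ c)) + 2) ^ 2
          ≤ 20 * N * (2 * N ^ (a₀ + 1)) * (2 * N) * N ^ 2 := by
            gcongr
            · omega
        _ = 80 * N ^ (a₀ + 5) := by ring
        _ ≤ N * N ^ (a₀ + 5) := Nat.mul_le_mul_right _ hT80
        _ = N ^ (a₀ + 6) := by ring
    have hdegP : (P n).totalDegree ≤ N ^ (a₀ + 6) := by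
      refine hPdeg.trans ?_
      calc 10 * ((H n).card + 1) * (N * N ^ a₀ + 1) *
            (Nat.log 2 (N * N ^ a₀ * (2 * s) ^ (n ^ c)) + 2) ^ 2
          ≤ 10 * N * (2 * N ^ (a₀ + 1)) * N ^ 2 := by gcongr
        _ = 20 * N ^ (a₀ + 4) := by ring
        _ ≤ N * N ^ (a₀ + 4) := Nat.mul_le_mul_right _ (by omega)
        _ = N ^ (a₀ + 5) := by ring
        _ ≤ N ^ (a₀ + 6) := Nat.pow_le_pow_right hN1 (by omega)
    -- (2) the `{-1,0,1}` witness of degree `≤ n^c` vanishing on `ℋ_n`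
    have hHabs : ∀ a ∈ H n, ∀ j, |a j| ≤ ((2 * s : ℕ) : ℤ) := by
      intro a ha j
      obtain ⟨h1, h2⟩ := hHB a ha j
      rw [abs_le]; constructor <;> linarith
    have hB1 : 1 ≤ 2 * s := by omega
    have hcount : (2 * (Nat.card (monomialsDegLE n (n ^ c)) * (2 * s) ^ (n ^ c)) + 1) ^
        (H n).card < 2 ^ Nat.card (monomialsDegLE n (n ^ c)) := by
      rw [hNcard]
      have hE : 2 * (N * (2 * s) ^ (n ^ c)) + 1 ≤
          2 ^ ((n + n ^ c) * (0 + 1) + n ^ c * ((L + 1) ^ 2 + 3) + 2) := by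
        have h0 := log_two_le_of_bounds N 0 (2 * s) (n ^ c) (n + n ^ c) ((L + 1) ^ 2 + 3) hNu h2s
        rw [pow_zero, mul_one] at h0
        have hlt := Nat.lt_pow_succ_log_self Nat.one_lt_two (N * (2 * s) ^ (n ^ c))
        have hmono : 2 ^ (Nat.log 2 (N * (2 * s) ^ (n ^ c)) + 1) ≤
            2 ^ ((n + n ^ c) * (0 + 1) + n ^ c * ((L + 1) ^ 2 + 3) + 1) :=
          Nat.pow_le_pow_right (by norm_num) (by omega)
        have e2 : 2 ^ ((n + n ^ c) * (0 + 1) + n ^ c * ((L + 1) ^ 2 + 3) + 2) =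
            2 * 2 ^ ((n + n ^ c) * (0 + 1) + n ^ c * ((L + 1) ^ 2 + 3) + 1) := by ring
        rw [e2]
        omega
      have hexp : (H n).card * ((n + n ^ c) * (0 + 1) + n ^ c * ((L + 1) ^ 2 + 3) + 2) < N :=
        lt_of_le_of_lt (Nat.mul_le_mul_right _ hHcard) hT3
      calc (2 * (N * (2 * s) ^ (n ^ c)) + 1) ^ (H n).card
          ≤ (2 ^ ((n + n ^ c) * (0 + 1) + n ^ c * ((L + 1) ^ 2 + 3) + 2)) ^ (H n).card :=
            Nat.pow_le_pow_left hE _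
        _ = 2 ^ ((H n).card * ((n + n ^ c) * (0 + 1) + n ^ c * ((L + 1) ^ 2 + 3) + 2)) := by
            rw [← pow_mul, mul_comm]
        _ < 2 ^ N := Nat.pow_lt_pow_right (by norm_num) hexp
    obtain ⟨g, hg0, hgd, hgs, hgv⟩ :=
      exists_signCoeff_vanishing_on ℂ n (n ^ c) (2 * s) hB1 (H n) hHabs hcount
    have hgbox : g ∈ intBoxSlice ℂ n (N ^ a₀) := signCoeffSlice_subset_intBoxSlice ℂ hA1 hgs
    have hgP : eval (coeffVector (monomialsDegLE n (n ^ c)) g) (P n) ≠ 0 := by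
      intro h0
      obtain ⟨a, ha, hne⟩ := (hPiff g hgd hgbox).mp h0 hg0
      exact hne (hgv a ha)
    exact ⟨⟨hsize, hdegP⟩,
      fun f hf hfbox => hvan f (vnpSlice_subset_definableSlice n (n ^ c) (n ^ (L + 1)) hf) hfbox,
      g, hgs, hgd, hgP⟩
  refine ⟨a₀ + 6, P, ⟨n₀, fun n hn => (main n hn).1⟩, fun k => ?_,
    ⟨n₀, fun n hn => (main n hn).2.2⟩⟩
  -- clause 2: for `n ≥ max n₀ 2^k`, `n^k ≤ n^{L+1}`, so `vnpSlice (n^k) ⊆ vnpSlice (n^{L+1})`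
  refine ⟨max n₀ (2 ^ k), fun n hn f hf hfbox => ?_⟩
  have hn₀ : n₀ ≤ n := le_trans (le_max_left _ _) hn
  have hnk : 2 ^ k ≤ n := le_trans (le_max_right _ _) hn
  have hn1 : 1 ≤ n := le_trans Nat.one_le_two_pow hnk
  have hkL : k ≤ Nat.log 2 n := Nat.le_log_of_pow_le Nat.one_lt_two hnk
  have hks : n ^ k ≤ n ^ (Nat.log 2 n + 1) := Nat.pow_le_pow_right hn1 (by omega)
  exact (main n hn₀).2.1 f (vnpSlice_mono_size hks hf) hfbox

/-! ### The `∃ a D, ∀ b` frame shape for the `VNP` slice, transported from `thm_1_3_intBox` at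
`c = 1` (as `CKRST2020_thm_1_3.frame` is from `CKRST2020_thm_1_3`) -/

/-- Evaluation at a coefficient vector is unchanged by the transport `CKRST2020.toFrame`
(re-proved: the tree's lemma is private to `CKRST20NaturalProofsExist.lean`). [folklore] -/
private theorem eval_coeffVector_toFrame' (n : ℕ) (Q : MvPolynomial (monomialsDegLE n (n ^ 1)) ℂ)
    (f : MvPolynomial (Fin n) ℂ) :
    eval (coeffVector (degLEMonomials n) f) (toFrame n Q) =
      eval (coeffVector (monomialsDegLE n (n ^ 1)) f) Q := by
  rw [toFrame, eval_rename]; rfl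

/-- The transport of a size-and-degree-`≤ binom(2n, n)^e` polynomial is a level-`e` distinguisher.
[folklore] -/
private theorem toFrame_mem_distinguishers' {n e : ℕ} {Q : MvPolynomial (monomialsDegLE n (n ^ 1)) ℂ}
    (hc : complexity Q ≤ ((2 * n).choose n) ^ e) (hd : Q.totalDegree ≤ ((2 * n).choose n) ^ e) :
    toFrame n Q ∈ Distinguishers ℂ n e := by
  refine ⟨?_, ?_⟩
  · rw [toFrame, complexity_rename_of_injective_holds (Equiv.injective _) Q]; exact hc
  · exact (totalDegree_rename_le _ _).trans hd

/-- From a `c = 1` statement of the `thm_1_x_intBox` shape (vanishing relative to `P n`, witness in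
the sign slice `⊆ P n`) to the frame `d = n`: one family of transported distinguishers.
[folklore] -/
private theorem frame_of_degOne_sign {P : ∀ n : ℕ, Set (MvPolynomial (Fin n) ℂ)}
    {𝒞 : ∀ n d t : ℕ, Set (MvPolynomial (Fin n) ℂ)} (hPS : ∀ n, signCoeffSlice ℂ n ⊆ P n)
    (h : ∃ (e : ℕ) (Q : (n : ℕ) → MvPolynomial (monomialsDegLE n (n ^ 1)) ℂ),
      (∃ n₀ : ℕ, ∀ n ≥ n₀, complexity (Q n) ≤ ((2 * n).choose n) ^ e ∧
        (Q n).totalDegree ≤ ((2 * n).choose n) ^ e) ∧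
      (∀ k : ℕ, ∃ n₀ : ℕ, ∀ n ≥ n₀, ∀ f ∈ 𝒞 n (n ^ 1) (n ^ k), f ∈ P n →
        eval (coeffVector (monomialsDegLE n (n ^ 1)) f) (Q n) = 0) ∧
      (∃ n₀ : ℕ, ∀ n ≥ n₀, ∃ g ∈ signCoeffSlice ℂ n, g.totalDegree ≤ n ^ 1 ∧
        eval (coeffVector (monomialsDegLE n (n ^ 1)) g) (Q n) ≠ 0)) :
    ∃ (a : ℕ) (D : (n : ℕ) → MvPolynomial (degLEMonomials n) ℂ), ∀ b : ℕ, ∃ n₀ : ℕ, ∀ n ≥ n₀,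
      IsNaturalProofRel (degLEMonomials n) (P n) (𝒞 n n (n ^ b)) (Distinguishers ℂ n a) (D n) ∧
        ∃ g ∈ signCoeffSlice ℂ n, g.totalDegree ≤ n ∧
          eval (coeffVector (degLEMonomials n) g) (D n) ≠ 0 := by
  obtain ⟨e, Q, ⟨n₁, hQ⟩, hvan, ⟨n₂, hwit⟩⟩ := h
  refine ⟨e, fun n => toFrame n (Q n), fun b => ?_⟩
  obtain ⟨n₃, hb⟩ := hvan b
  refine ⟨max (max n₁ n₂) n₃, fun n hn => ?_⟩
  have h1 : n₁ ≤ n := le_trans (le_trans (le_max_left _ _) (le_max_left _ _)) hn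
  have h2 : n₂ ≤ n := le_trans (le_trans (le_max_right _ _) (le_max_left _ _)) hn
  have h3 : n₃ ≤ n := le_trans (le_max_right _ _) hn
  obtain ⟨g, hgS, hgdeg, hgne⟩ := hwit n h2
  have hgne' : eval (coeffVector (degLEMonomials n) g) (toFrame n (Q n)) ≠ 0 := by
    rwa [eval_coeffVector_toFrame']
  refine ⟨⟨toFrame_mem_distinguishers' (hQ n h1).1 (hQ n h1).2, ⟨g, hPS n hgS, hgne'⟩, ?_⟩,
    g, hgS, by simpa only [pow_one] using hgdeg, hgne'⟩
  intro f hf hfP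
  rw [eval_coeffVector_toFrame']
  exact hb n h3 f (by simpa only [pow_one] using hf) hfP

/-- **Theorem 1.8 for the box, in the `∃ a D, ∀ b` frame shape of `CKRST2020_thm_1_3.frame`:**
ONE family `D_n ∈ Distinguishers ℂ n a` which, for EVERY `b` and all large `n`, is a natural proof
relative to the box `[-binom(2n,n)^{a₀}, binom(2n,n)^{a₀}]` against `SmallDefinable ℂ n b` and is
nonzero at some `{-1,0,1}`-polynomial of degree `≤ n` — transported from `thm_1_3_intBox` at `c = 1`
along `n^1 = n` (cf. `intBox_frame_vnp`: `∀ a₀ b`, a family per `b`; `intBox_frame'`: the `VP`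
analogue). [cite: ChatterjeeKumarRamyaSaptharishiTengse2020, Thm. 1.8 with the remark after it (arXiv v4, TeX L300)] -/
theorem intBox_frame_vnp' (a₀ : ℕ) :
    ∃ (a : ℕ) (D : (n : ℕ) → MvPolynomial (degLEMonomials n) ℂ), ∀ b : ℕ, ∃ n₀ : ℕ, ∀ n ≥ n₀,
      IsNaturalProofRel (degLEMonomials n) (intBoxSlice ℂ n (((2 * n).choose n) ^ a₀))
          (SmallDefinable ℂ n b) (Distinguishers ℂ n a) (D n) ∧
        ∃ h ∈ signCoeffSlice ℂ n, h.totalDegree ≤ n ∧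
          eval (coeffVector (degLEMonomials n) h) (D n) ≠ 0 := by
  have hN : ∀ n : ℕ, (n + n ^ 1).choose n = (2 * n).choose n := fun n => by rw [pow_one, two_mul]
  have h := thm_1_3_intBox a₀ 1 le_rfl
  simp only [hN] at h
  exact frame_of_degOne_sign (P := fun n => intBoxSlice ℂ n (((2 * n).choose n) ^ a₀))
    (𝒞 := vnpSlice ℂ)
    (fun n => signCoeffSlice_subset_intBoxSlice ℂ (Nat.one_le_pow _ _ (Nat.choose_pos (by omega)))) h

/-- Hence, uniformly in `b`: for all large `n`, `Distinguishers ℂ n a` (one `a` for all `b`) has NO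
`SmallDefinable ℂ n b`-succinct hitting set relative to the box `[-binom(2n,n)^{a₀}, binom(2n,n)^{a₀}]`
(the `∃ a ∀ b` strengthening of `not_isSuccinctHittingSetRel_intBox_vnp`).
[cite: ChatterjeeKumarRamyaSaptharishiTengse2020, Thm. 1.8 with the remark after it (arXiv v4, TeX L300)] -/
theorem not_isSuccinctHittingSetRel_intBox_vnp' (a₀ : ℕ) : ∃ a : ℕ, ∀ b : ℕ, ∃ n₀ : ℕ, ∀ n ≥ n₀,
    ¬ IsSuccinctHittingSetRel (degLEMonomials n) (intBoxSlice ℂ n (((2 * n).choose n) ^ a₀))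
        (SmallDefinable ℂ n b) (Distinguishers ℂ n a) := by
  obtain ⟨a, D, hD⟩ := intBox_frame_vnp' a₀
  refine ⟨a, fun b => ?_⟩
  obtain ⟨n₀, h⟩ := hD b
  refine ⟨n₀, fun n hn => ?_⟩
  obtain ⟨hrel, -⟩ := h n hn
  exact (exists_isNaturalProofRel_iff _ _ _ _).1 ⟨D n, hrel⟩

/-! ### FSV's relative technique class: the box distinguishers are a natural proof against `VP`
relative to the box, for the (chosen) family of their `{-1,0,1}` non-roots -/

/-- From the `∃ D, ∀ b` frame shape with sign-slice witnesses to FSV's relative technique class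
`NaturalProofAgainstVPRel` (FSV Def. 1 relative to `P`): the family `D` is a `P`-relative natural
proof at level `a` against the target family of its `{-1,0,1}` non-roots (a family obtained by
choice from the witnesses — inexplicit; by `exists_not_mem_smallCircuits_of_rel` such a target is,
for every `b`, infinitely often outside `SmallCircuits ℂ n b`, which for an inexplicit `{-1,0,1}`
family is no more than counting gives).
[cite: ForbesShpilkaVolk2018, Def. 1; ChatterjeeKumarRamyaSaptharishiTengse2020, Thm. 1.6 (MainThmComplex)] -/
theorem naturalProofAgainstVPRel_of_frame {P : ∀ n : ℕ, Set (MvPolynomial (Fin n) ℂ)} {a : ℕ}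
    {D : (n : ℕ) → MvPolynomial (degLEMonomials n) ℂ}
    (hD : ∀ b : ℕ, ∃ n₀ : ℕ, ∀ n ≥ n₀,
      IsNaturalProofRel (degLEMonomials n) (P n) (SmallCircuits ℂ n b) (Distinguishers ℂ n a) (D n) ∧
        ∃ g ∈ signCoeffSlice ℂ n, g.totalDegree ≤ n ∧
          eval (coeffVector (degLEMonomials n) g) (D n) ≠ 0) :
    ∃ h : (n : ℕ) → MvPolynomial (Fin n) ℂ,
      (∀ n, h n ∈ signCoeffSlice ℂ n ∧ (h n).totalDegree ≤ n) ∧ NaturalProofAgainstVPRel ℂ P a h := by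
  classical
  obtain ⟨n₀, h₀⟩ := hD 0
  -- the target: the witness of the `b = 0` instance where available, `0` below the threshold
  have hw : ∀ n, ∃ g : MvPolynomial (Fin n) ℂ, g ∈ signCoeffSlice ℂ n ∧ g.totalDegree ≤ n ∧
      (n₀ ≤ n → eval (coeffVector (degLEMonomials n) g) (D n) ≠ 0) := by
    intro n
    by_cases hn : n₀ ≤ n
    · obtain ⟨-, g, hg, hgd, hgne⟩ := h₀ n hn
      exact ⟨g, hg, hgd, fun _ => hgne⟩
    · exact ⟨0, fun m => Or.inl (coeff_zero m), by simp, fun h => absurd h hn⟩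
  choose h hhS hhd hhne using hw
  refine ⟨h, fun n => ⟨hhS n, hhd n⟩, fun b n₁ => ?_⟩
  obtain ⟨nb, hb⟩ := hD b
  refine ⟨max (max n₁ n₀) nb, le_trans (le_max_left _ _) (le_max_left _ _), D _, ?_⟩
  obtain ⟨⟨hDmem, -, hvan⟩, -⟩ := hb _ (le_max_right _ _)
  exact ⟨hDmem, hvan, hhne _ (le_trans (le_max_right _ _) (le_max_left _ _))⟩

/-- **Natural proofs against `VP` relative to the box `[-binom(2n,n)^{a₀}, binom(2n,n)^{a₀}]` EXIST**
(FSV's technique class `NaturalProofAgainstVPRel`, level `a₀ + 6`), for a `{-1,0,1}` target family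
of degree `≤ n` (inexplicit, chosen from the non-roots of `intBox_frame_uniform`); contrast
`not_naturalProofAgainstVPRel` (`AlgebraicNaturalProofs.lean`): the `P`-relative hypothesis would
forbid this, and indeed it fails for the box (`not_succinctHittingSetsForVPRel_intBox`).
[cite: ChatterjeeKumarRamyaSaptharishiTengse2020, Thm. 1.6 with the §1.3 remark after it; ForbesShpilkaVolk2018, Def. 1] -/
theorem exists_naturalProofAgainstVPRel_intBox (a₀ : ℕ) :
    ∃ h : (n : ℕ) → MvPolynomial (Fin n) ℂ, (∀ n, h n ∈ signCoeffSlice ℂ n ∧ (h n).totalDegree ≤ n) ∧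
      NaturalProofAgainstVPRel ℂ (fun n => intBoxSlice ℂ n (((2 * n).choose n) ^ a₀)) (a₀ + 6) h := by
  obtain ⟨D, hD⟩ := intBox_frame_uniform a₀
  exact naturalProofAgainstVPRel_of_frame (P := fun n => intBoxSlice ℂ n (((2 * n).choose n) ^ a₀)) hD

end CKRST2020

/-! ### `CKRST2020_thm_1_1` and `CKRST2020_thm_1_3` HOLD — inside `Literature/` (the box theorems
at `a₀ = 0`; the tree's first proofs are the route-side `…AsPrinted.ckrst2020_thm_1_1_holds` /
`…VNPAsPrinted.ckrst2020_thm_1_3_holds` under `Summits/`, which `Literature/` cannot import) -/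

/-- **`CKRST2020_thm_1_1` (Theorem 1.6 as printed) holds**: `CKRST2020.thm_1_1_intBox` at `a₀ = 0`
(the box `[-1, 1]` contains the sign slice). This makes the `(hT : CKRST2020_thm_1_1)` corollaries of
`CKRST20NaturalProofsExist.lean` (`.frame`, `.forall_exists`, `.not_succinctHittingSetsForVPRel`)
unconditional within the Literature cone; the route-side proof
`Summit.….BarrierLever.NaturalProofsSeparateVNP.AsPrinted.ckrst2020_thm_1_1_holds` is the tree's first.
[cite: ChatterjeeKumarRamyaSaptharishiTengse2020, Thm. 1.6 (MainThmComplex), proof in §4 (arXiv v4)] -/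
theorem CKRST2020_thm_1_1_holds : CKRST2020_thm_1_1 := by
  intro c hc
  obtain ⟨e, P, hsize, hvan, hwit⟩ := CKRST2020.thm_1_1_intBox 0 c hc
  refine ⟨e, P, hsize, fun k => ?_, hwit⟩
  obtain ⟨n₀, h⟩ := hvan k
  exact ⟨n₀, fun n hn f hf hfs =>
    h n hn f hf (signCoeffSlice_subset_intBoxSlice ℂ (by rw [pow_zero]) hfs)⟩

/-- **`CKRST2020_thm_1_3` (Theorem 1.8 as printed) holds**: `CKRST2020.thm_1_3_intBox` at `a₀ = 0`;
makes `CKRST2020_thm_1_3.frame` / `.not_isSuccinctHittingSetRel` unconditional within `Literature/`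
(route-side twin: `Summit.….VNPAsPrinted.ckrst2020_thm_1_3_holds`).
[cite: ChatterjeeKumarRamyaSaptharishiTengse2020, Thm. 1.8 (VNPboundedCoeff), proof: Lemma 3.7 + Thm. 4.3 (arXiv v4)] -/
theorem CKRST2020_thm_1_3_holds : CKRST2020_thm_1_3 := by
  intro c hc
  obtain ⟨e, Q, hsize, hvan, hwit⟩ := CKRST2020.thm_1_3_intBox 0 c hc
  refine ⟨e, Q, hsize, fun k => ?_, hwit⟩
  obtain ⟨n₀, h⟩ := hvan k
  exact ⟨n₀, fun n hn f hf hfs =>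
    h n hn f hf (signCoeffSlice_subset_intBoxSlice ℂ (by rw [pow_zero]) hfs)⟩

/-- Hence, unconditionally inside `Literature/`: the `{-1,0,1}`-relative hypothesis
`SuccinctHittingSetsForVPRel ℂ (signCoeffSlice ℂ)` ("FALSE in print", `AlgebraicNaturalProofs.lean`)
is false. [cite: ChatterjeeKumarRamyaSaptharishiTengse2020, Thm. 1.6 and §1.4] -/
theorem CKRST2020.not_succinctHittingSetsForVPRel_signCoeffSlice :
    ¬ SuccinctHittingSetsForVPRel ℂ (signCoeffSlice ℂ) :=
  CKRST2020_thm_1_1.not_succinctHittingSetsForVPRel CKRST2020_thm_1_1_holds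

/-- And natural proofs against `VP` relative to the sign slice EXIST (FSV's technique class, some
level `a`, a `{-1,0,1}` target family of degree `≤ n`, inexplicit).
[cite: ChatterjeeKumarRamyaSaptharishiTengse2020, Thm. 1.6 (MainThmComplex); ForbesShpilkaVolk2018, Def. 1] -/
theorem CKRST2020.exists_naturalProofAgainstVPRel_signCoeffSlice :
    ∃ (a : ℕ) (h : (n : ℕ) → MvPolynomial (Fin n) ℂ),
      (∀ n, h n ∈ signCoeffSlice ℂ n ∧ (h n).totalDegree ≤ n) ∧
        NaturalProofAgainstVPRel ℂ (signCoeffSlice ℂ) a h := by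
  obtain ⟨a, D, hD⟩ := CKRST2020_thm_1_1_holds.frame
  exact ⟨a, CKRST2020.naturalProofAgainstVPRel_of_frame hD⟩


end Literature.Barriers.ValiantsHypothesis
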